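import Mathlib
import Literature.MathematicalPhysics.QuantumLattice.FermiRG.Salmhofer1998OverlappingLoopInputs
import HarnessLib

/-!
# Salmhofer 1998 Lemma 7, clause (6.9): the overlapping-loop VOLUME-IMPROVEMENT bound — proved for the
# many-fermion propagator from the two-shell phase-space volume

Theorem-only companion (plus one `Prop`-valued hypothesis predicate) of F7e `Salmhofer1998Sec6.lean` and of
F7ad `Salmhofer1998OverlappingLoopInputs.lean` (gate-hubbard-kl wave, t7 g11).  M. Salmhofer, *Continuous
renormalization for fermions and Fermi liquid theory*, Commun. Math. Phys. **194** (1998) 249–295 =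
arXiv:cond-mat/9706188 [Salmhofer1998]; locators `p.N Ln` = chunk `pNNNN.txt` line `n` of the materialised
arXiv TeX (`lit read arxiv:cond-mat/9706188`), NOT printed pages; stable locators are the paper's numbers.

Lemma 7 (p.22 L117 – p.23 L37; named fact `OverlappingLoopBound`, licence F-091) has three conclusions for the
overlapping-loop functional `Y_{α,i}(t)` (6.7) of the many-fermion propagator (5.17): (o) vanishing beyond
`log(βε₀/π)`, (6.8), and the volume-improved bound **(6.9)**: for `i ≥ 3`,
`Y_{α,i}(t) ≤ (8J₁)^{i-1} B_α K₀ ½(1+t) ε_t^{i-1-|α|}` (`d = 2`; without `½(1+t)` for `d ≥ 3`, (6.16)) with `K₀`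
INDEPENDENT OF `β` ((6.14)).  F7ad proved (o) and (6.8) and reduced the named fact to (6.9)
(`overlappingLoopBound_of_69`).  THIS file proves (6.9), following the printed proof (p.22 L133 – p.23 L37)
step by step, from the one geometric input that proof takes from outside §5–§6 — the two-loop volume bound of
Lemma 6 (= [FST2] Theorem 1.1, tree `FermiRG.VolumeBound`, licence F-090) read through the low-energy chart
`(ρ, θ)` of §2.3 (displays (6.11)–(6.12) below) — kept as the hypothesis predicate `TwoShellVolumeBound M V`
(never asserted).

DISPLAY LABELS.  The arXiv render carries no equation numbers.  (6.7)–(6.9) (statement of Lemma 7) and (6.14)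
(`K₀`, TeX `\Kodef`) are the labels fixed in F7e; for the displays of the PROOF of Lemma 7 this file uses, with
the render lines as the authoritative locator: (6.10) := "`Y_{α,i}(t) ≤ (∫_{ℝ×𝓑}|Ĉ_t(k)|dk)^{i-3} sup_Q max_{v₁,v₂}
Y_α(t,Q,v₁,v₂)`" (p.22 L143–148, with `Y_α(t,Q,v₁,v₂) = ∫dk₁∫dk₂ |Ĉ_t(k₁)||Ĉ_t(k₂)||D^αĊ_t(v₁k₁+v₂k₂+Q)|`,
p.22 L152–157, and "`Y_α ≤ 8² B_α ε_t^{-1-|α|} ∫_t dt₁ ∫_t dt₂ 𝒱(t,t₁,t₂)`", p.22 L165–170); (6.11) := the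
region/volume "`𝒱(t,t₁,t₂) = ∫_{𝓡(ε₀e^{-t₁})}d𝐤₁ ∫_{𝓡(ε₀e^{-t₂})}d𝐤₂ 1(|E(v₁𝐤₁+v₂𝐤₂+𝐪)| ≤ ε₀e^{-t})`" (p.22
L174–179); (6.12) := "`𝒱(t,t₁,t₂) ≤ (2ε₀J₀)² e^{-t₁-t₂} 𝓦((1+4|E|₁/g₀)ε₀e^{-t})`" (p.23 L18–21); (6.13) := "`Y_α ≤
4⁴ B_α J₀² ε_t^{1-|α|} 𝓦((1+4|E|₁/g₀)ε₀e^{-t})`" (p.23 L25–28).  Lemma 6 = p.22 L46–62 (its bound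
`𝓦(ε) ≤ Q_V ε (1+|log ε|)` / `Q_V ε`, p.22 L57–62).

The steps:

* **(6.10), the factor `(∫|Ĉ_t|)^{i-3}`** — `loopY_succ_le`, `loopY_le_loopY_two_mul_pow`: for ANY scale family
  with measurable `Ĉ_t(ω_β(·),·)`, `Y_{α,m+2}(t) ≤ Y_{α,m+1}(t) · ∫_{ℝ×𝓑}|Ĉ_t|` (Tonelli on
  `(ℝ×𝓑)^{m+1} = (ℝ×𝓑) × (ℝ×𝓑)^m`, the momentum of the peeled line absorbed into the transfer `Q`), hence
  `Y_{α,3+m}(t) ≤ Y_{α,3}(t) (∫|Ĉ_t|)^m`;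
* **"I use `Ċ_t = 0` for `t > log(βε₀/π)` to write `Ĉ_t(k_j) = -∫_t^{log βε₀} dt_j Ċ_{t_j}(k_j)`. By (5.18),
  `|Ċ_t(p)| ≤ B₀ ε_t⁻¹ 1(|E(𝐩)| ≤ ε_t)`"** (p.22 L159–163) — `enorm_modelProp_toMats_le_lintegral_scaleLine`:
  `|D̂_t(k)| ≤ ∫_t^∞ ds 4ε_s⁻¹ 1(|ω_β(k₀)| ≤ ε_s) 1(|E(𝐤)| ≤ ε_s)` (tree `enorm_cutoffCovInf_le_lintegral` +
  `norm_deriv_cutoffCovInf_le'`, `B₀ = 4`);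
* **"doing the integrals over `(k₁)₀` and `(k₂)₀`"** (p.22 L160–163) — `lintegral_freqInd_le` (tree (5.19′)
  `vol{|ω_β| ≤ ε} ≤ 4ε`, uniformly in `β`) and the Tonelli factorisation `setLIntegral_twoLine_factor`;
* **(6.11)–(6.12) with Lemma 6** — the hypothesis `TwoShellVolumeBound M V`: the Lebesgue volume of print's region
  (6.11), `𝒱 = vol{(𝐤₁,𝐤₂) ∈ 𝓡(ε₁)×𝓡(ε₂) ∩ 𝓑² : |E(v₁𝐤₁+v₂𝐤₂+𝐪)| ≤ ε}`, is at most `V ε₁ ε₂ ε (1+δ_{d,2}|log ε|)`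
  for `0 < ε₁, ε₂ ≤ ε ≤ ε₀` (print: `𝒱(t,t₁,t₂) ≤ (2ε₀J₀)² e^{-t₁-t₂} 𝓦((1+4|E|₁/g₀)ε₀e^{-t})` by the chart with
  Jacobian `J ≤ J₀`, and `𝓦(ε) ≤ Q_V ε(1+|log ε|)` / `Q_V ε` by Lemma 6); at fixed scales this gives
  `setLIntegral_scalePair_le`;
* **(6.13)–(6.14)** — `lintegral_scales_eq` (`∫_t^∞∫_t^∞ ε_{s₁}ε_{s₂} = ε_t²`), `logFactor_le_twoLoopFactor`
  (`1 + δ_{d,2}|log ε_t| ≤ 2(1+|log ε₀|)·((1+t)/2)^{δ_{d,2}}`), `loopY_two_modelProp_le` (the two overlapping lines: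
  `Y_{α,3}(t) ≤ b · 256 w₁² V ε_t³ (1+δ_{d,2}|log ε_t|)` for `|D^αĊ_t| ≤ b·1·1`), and the assembly
  `loopY_modelProp_le_69_core` with the explicit `β`-independent constant
  `K₀ = volK₀ M V J₁ = 8 w₁² max(V,1)(1+|log ε₀|)/J₁²` (`w₁ = (2π)^{-(d+1)}`; print's (6.14) has
  `K₀ = 2(J₀/J₁)² Q_V (1+4|E|₁/g₀)(1 + log(1+4|E|₁/g₀) + |log ε₀|)` — the same dependence, `V` standing for
  `4J₀²Q_V(1+4|E|₁/g₀)(1+log(1+4|E|₁/g₀))`).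

Headline statements:
* `loopY_modelProp_le_69_of_twoShellVolume` — **(6.9) for the many-fermion propagator** in the exact binder shape
  of `overlappingLoopBound_of_69`'s hypothesis (constants `B_α, J₁` characterised by (5.18)/(5.21) in the window
  `βε₀ ≥ 6`; `∃ K₀ > 0` before `β`);
* `overlappingLoopBound_of_twoShellVolume` — **`(∀ models of the §2.3 class, ∃ V, TwoShellVolumeBound M V) →
  OverlappingLoopBound`**: licence F-091 is thereby reduced to the phase-space geometry alone (Lemma 6 + the
  chart Jacobian bound, i.e. the content of F-090 transported to the model's coordinates);
* `loopBoundsHold_modelProp_of_twoShellVolume` — **the standing hypothesis `LoopBoundsHold` of Theorems 3–7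
  (F7e) for the many-fermion propagator follows from `TwoShellVolumeBound M V` alone**, for every `β > 0`, with
  the constants of Lemma 4 (`B = max(B₀,B₁,B₂)`, `J₁` of (5.21)) and `K₀ = volK₀ M V J₁`;
* `lemma7_modelProp_of_twoShellVolume` — Lemma 7's three conclusions for such a model.

Faithfulness.  (i) The functional is F7e's `loopY` (supremum over ALL real transfers `Q`; print's `Q ∈ 𝕄(β)×𝓑`
version `loopYM` is smaller, `loopYM_le_loopY`), as in `OverlappingLoopBound`'s clause (6.9).  (ii) The
frequency indicator `1(|x| ≤ ε_t)` of (5.18) on the differentiated line is discarded (`≤ 1`), exactly as print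
does ("By (5.18), `|D^αĊ_t(p)| ≤ B_α ε_t^{-1-|α|} 1(|E(𝐩)| ≤ ε_t)`", p.22 L165–167).  (iii) The scale
representation is used as the inequality `|Ĉ_t(k)| ≤ ∫_t^T |Ċ_s(k)| ds ≤ ∫_t^∞ (majorant)`, `T > log(βε₀/π)`
(tree, Lemma 4), so no `β` enters the constants; all `β`-dependence is in `ω_β`, whose level sets have length
`≤ 4ε` uniformly in `β`.  (iv) Constants: print's `8²` and `4⁴` are replaced by the explicit `256 w₁²`
bookkeeping of this normalisation (`∫dk = ∫d^{d+1}k/(2π)^{d+1}`); `K₀` is existential in the named fact and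
explicit here.  (v) The hypothesis predicate is print's intermediate display, not a restatement of (6.9): it
speaks of Lebesgue volumes of level sets of `E` only (no propagator, cutoff, frequency or `β`), and for the
Hubbard band it is within reach of the programme's polar-coordinate machinery
(`Summits/…/KLProgrammeFermiSurfaceTwoLoop*.lean`, which proves the `d = 2` clause of `VolumeBound`'s conclusion
for that band); in general it is Lemma 6 composed with the chart of §2.3 (`IsLowEnergyChart`, F7b).

No `instance`, no `notation`, no sorry/axiom; no named fact is introduced (net debt 0); nothing about the
Hubbard model is asserted or denied.
-/

noncomputable section

open MeasureTheory Filter Set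
open scoped Topology ENNReal

namespace Literature.MathematicalPhysics.QuantumLattice.FermiRG

namespace Salmhofer1998

variable {d : ℕ}

/-- `w_{m+1} = w_1 · w_m` for the loop normalisation `w_n = ((2π)^{-(d+1)})^n`.
[cite: Salmhofer1998, Lemma 4 (5.20)–(5.21) (p.19 L154–164)] -/
theorem loopWeight_succ (d m : ℕ) : loopWeight d (m + 1) = loopWeight d 1 * loopWeight d m := by
  simp [loopWeight, pow_succ, mul_comm]

/-- The loop region `(ℝ × 𝓑)^n` with its volume is the product of `n` copies of `ℝ × 𝓑` with its volume
(the measure behind `∫ dK₂ … dK_i`, p.17 L141). [cite: Salmhofer1998, §5.1 (p.17 L139–152)] -/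
theorem volume_restrict_loopSet (d : ℕ) (latt : ℝ) (n : ℕ) :
    (volume : Measure (Fin n → FMom d)).restrict (loopSet d latt n) =
      Measure.pi fun _ : Fin n => (volume : Measure (FMom d)).restrict ((univ : Set ℝ) ×ˢ bzBox d latt) := by
  rw [loopSet, MeasureTheory.volume_pi, Measure.restrict_pi_pi]

/-- (6.7) unfolded: `Y_{α,n+1}(t)` is the supremum over transfers `Q` and signs `v` of the `n`-line integral.
[cite: Salmhofer1998, §6.1 (6.7) (p.22 L108–115)] -/
theorem loopY_eq_iSup (latt β : ℝ) (C Cdot : ℝ → FMom d → ℂ) (α : Fin d → ℕ) (n : ℕ) (t : ℝ) :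
    loopY latt β C Cdot α n t = ⨆ Q : FMom d, ⨆ v : Fin n → Bool,
      ∫⁻ k in loopSet d latt n,
        ENNReal.ofReal (loopWeight d n) * (∏ j, ‖C t (toMats β (k j))‖ₑ) *
          ‖multiMomPartial α (Cdot t) ((∑ j, (if v j then (1 : ℝ) else -1) • toMats β (k j)) + Q)‖ₑ := rfl

/-- **Peeling one integrated line** (the first step of the proof of (6.9), display (6.10), p.22 L143–148:
"`Y_{α,i}(t) ≤ (∫_{ℝ×𝓑} |Ĉ_t(k)| dk)^{i-3} sup_{Q} max_{v₁,v₂} Y_α(t,Q,v₁,v₂)`", one line at a time): for ANY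
scale family with `k ↦ Ĉ_t(ω_β(k₀), 𝐤)` measurable, `Y_{α,m+2}(t) ≤ Y_{α,m+1}(t) · ∫_{ℝ×𝓑} dk/(2π)^{d+1} |Ĉ_t|`
— integrate the last line at fixed values of the others, absorbing its momentum `±k` into the transfer `Q`
(Tonelli on `(ℝ × 𝓑)^{m+1} = (ℝ × 𝓑) × (ℝ × 𝓑)^m`). [cite: Salmhofer1998, Lemma 7 proof (6.10) (p.22 L143–148)] -/
theorem loopY_succ_le (latt β : ℝ) {C Cdot : ℝ → FMom d → ℂ} (α : Fin d → ℕ) (m : ℕ) {t : ℝ}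
    (hC : Measurable fun k : FMom d => C t (toMats β k)) :
    loopY latt β C Cdot α (m + 1) t ≤ loopY latt β C Cdot α m t * propL1 latt β C t := by
  classical
  rw [loopY_eq_iSup latt β C Cdot α (m + 1) t]
  refine iSup_le fun Q => iSup_le fun v => ?_
  -- the integrand of the `(m+1)`-line functional
  set G : (Fin (m + 1) → FMom d) → ℝ≥0∞ := fun k =>
    ENNReal.ofReal (loopWeight d (m + 1)) * (∏ j, ‖C t (toMats β (k j))‖ₑ) *
      ‖multiMomPartial α (Cdot t) ((∑ j, (if v j then (1 : ℝ) else -1) • toMats β (k j)) + Q)‖ₑ with hG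
  -- split off the last line
  have hmp : MeasurePreserving (MeasurableEquiv.piFinSuccAbove (fun _ : Fin (m + 1) => FMom d) (Fin.last m))
      (Measure.pi fun _ : Fin (m + 1) => (volume : Measure (FMom d)).restrict ((univ : Set ℝ) ×ˢ bzBox d latt))
      (((volume : Measure (FMom d)).restrict ((univ : Set ℝ) ×ˢ bzBox d latt)).prod
        (Measure.pi fun _ : Fin m => (volume : Measure (FMom d)).restrict ((univ : Set ℝ) ×ˢ bzBox d latt))) :=
    measurePreserving_piFinSuccAbove
      (fun _ : Fin (m + 1) => (volume : Measure (FMom d)).restrict ((univ : Set ℝ) ×ˢ bzBox d latt)) (Fin.last m)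
  have hstep1 : ∫⁻ k in loopSet d latt (m + 1), G k =
      ∫⁻ p, G ((MeasurableEquiv.piFinSuccAbove (fun _ : Fin (m + 1) => FMom d) (Fin.last m)).symm p)
        ∂(((volume : Measure (FMom d)).restrict ((univ : Set ℝ) ×ˢ bzBox d latt)).prod
          (Measure.pi fun _ : Fin m => (volume : Measure (FMom d)).restrict ((univ : Set ℝ) ×ˢ bzBox d latt))) := by
    rw [volume_restrict_loopSet]
    exact ((hmp.symm _).lintegral_comp_emb (MeasurableEquiv.measurableEmbedding _) G).symm
  -- the data of the remaining `m` lines after absorbing the last momentum into `Q`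
  set v' : Fin m → Bool := fun j => v (Fin.castSucc j) with hv'
  set c : ℝ := if v (Fin.last m) then (1 : ℝ) else -1 with hc
  have hGe : ∀ (a : FMom d) (b : Fin m → FMom d),
      G ((MeasurableEquiv.piFinSuccAbove (fun _ : Fin (m + 1) => FMom d) (Fin.last m)).symm (a, b)) =
      (ENNReal.ofReal (loopWeight d 1) * ‖C t (toMats β a)‖ₑ) *
        (ENNReal.ofReal (loopWeight d m) * (∏ j, ‖C t (toMats β (b j))‖ₑ) *
          ‖multiMomPartial α (Cdot t)
            ((∑ j, (if v' j then (1 : ℝ) else -1) • toMats β (b j)) + (c • toMats β a + Q))‖ₑ) := by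
    intro a b
    have hsymm : (MeasurableEquiv.piFinSuccAbove (fun _ : Fin (m + 1) => FMom d) (Fin.last m)).symm (a, b) =
        Fin.insertNth (Fin.last m) a b := by
      rw [MeasurableEquiv.piFinSuccAbove_symm_apply]; rfl
    simp only [hG, hsymm]
    rw [Fin.prod_univ_succAbove _ (Fin.last m), Fin.sum_univ_succAbove _ (Fin.last m),
      Fin.insertNth_apply_same]
    simp only [Fin.insertNth_apply_succAbove]
    simp only [Fin.succAbove_last]
    rw [loopWeight_succ, ENNReal.ofReal_mul (loopWeight_nonneg d 1)]
    have hsum : (c • toMats β a + ∑ j : Fin m, (if v' j then (1 : ℝ) else -1) • toMats β (b j)) + Q =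
        (∑ j : Fin m, (if v' j then (1 : ℝ) else -1) • toMats β (b j)) + (c • toMats β a + Q) := by
      abel
    rw [← hsum]
    ring
  have hinner : ∀ a : FMom d,
      ∫⁻ b, G ((MeasurableEquiv.piFinSuccAbove (fun _ : Fin (m + 1) => FMom d) (Fin.last m)).symm (a, b))
        ∂(Measure.pi fun _ : Fin m => (volume : Measure (FMom d)).restrict ((univ : Set ℝ) ×ˢ bzBox d latt)) ≤
      (ENNReal.ofReal (loopWeight d 1) * ‖C t (toMats β a)‖ₑ) * loopY latt β C Cdot α m t := by
    intro a
    simp_rw [hGe a]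
    rw [lintegral_const_mul' _ _ (by finiteness), ← volume_restrict_loopSet]
    gcongr
    rw [loopY_eq_iSup]
    exact le_iSup_of_le (c • toMats β a + Q) (le_iSup_of_le v' le_rfl)
  calc ∫⁻ k in loopSet d latt (m + 1), G k
      = _ := hstep1
    _ ≤ ∫⁻ a, ∫⁻ b, G ((MeasurableEquiv.piFinSuccAbove (fun _ : Fin (m + 1) => FMom d) (Fin.last m)).symm
          (a, b)) ∂(Measure.pi fun _ : Fin m => (volume : Measure (FMom d)).restrict
            ((univ : Set ℝ) ×ˢ bzBox d latt))
          ∂((volume : Measure (FMom d)).restrict ((univ : Set ℝ) ×ˢ bzBox d latt)) := lintegral_prod_le _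
    _ ≤ ∫⁻ a, (ENNReal.ofReal (loopWeight d 1) * ‖C t (toMats β a)‖ₑ) * loopY latt β C Cdot α m t
          ∂((volume : Measure (FMom d)).restrict ((univ : Set ℝ) ×ˢ bzBox d latt)) :=
        lintegral_mono hinner
    _ = loopY latt β C Cdot α m t * propL1 latt β C t := by
        rw [lintegral_mul_const _ ((hC.enorm).const_mul _), propL1, lintegral_const_mul _ hC.enorm, mul_comm]

/-- **(6.10), the factor `(∫|Ĉ_t|)^{i-3}`**: with `2 + m` integrated lines (`i = 3 + m`),
`Y_{α,i}(t) ≤ Y_{α,3}(t) · (∫_{ℝ×𝓑} dk/(2π)^{d+1} |Ĉ_t|)^m`, for any scale family with measurable `Ĉ_t(ω_β(·), ·)`.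
[cite: Salmhofer1998, Lemma 7 proof (6.10) (p.22 L143–148)] -/
theorem loopY_le_loopY_two_mul_pow (latt β : ℝ) {C Cdot : ℝ → FMom d → ℂ} (α : Fin d → ℕ) {t : ℝ}
    (hC : Measurable fun k : FMom d => C t (toMats β k)) (m : ℕ) :
    loopY latt β C Cdot α (2 + m) t ≤ loopY latt β C Cdot α 2 t * propL1 latt β C t ^ m := by
  induction m with
  | zero => simp
  | succ m ih =>
    calc loopY latt β C Cdot α (2 + (m + 1)) t = loopY latt β C Cdot α (2 + m + 1) t := by rw [add_assoc]
      _ ≤ loopY latt β C Cdot α (2 + m) t * propL1 latt β C t := loopY_succ_le latt β α (2 + m) hC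
      _ ≤ loopY latt β C Cdot α 2 t * propL1 latt β C t ^ m * propL1 latt β C t := by gcongr
      _ = loopY latt β C Cdot α 2 t * propL1 latt β C t ^ (m + 1) := by rw [pow_succ, mul_assoc]


/-! ### The scale decomposition of the two overlapping lines and the two-shell volume -/

/-- `ε_s = ε₀e^{-s}` is antitone in `s` (`t ≤ t_j` gives `ε_{t_j} ≤ ε_t`, used as "`|ρ_j| ≤ ε₀e^{-t_j} ≤ ε₀e^{-t}`",
p.23 L11). [cite: Salmhofer1998, §5.2 (5.8) (p.18 L19–25) and Lemma 7 proof (p.23 L11)] -/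
theorem epsT_le_epsT_of_le {eps0 : ℝ} (h0 : 0 ≤ eps0) {s s' : ℝ} (h : s ≤ s') :
    epsT eps0 s' ≤ epsT eps0 s := by
  unfold epsT
  exact mul_le_mul_of_nonneg_left (Real.exp_le_exp.mpr (neg_le_neg h)) h0

/-- The frequency indicator `1(|ω_β(k₀)| ≤ ε_s)` of (5.18) (second line) as an `ℝ≥0∞`-valued function of
`(s, k₀)` (proof device). [cite: Salmhofer1998, Lemma 4 (5.18) (p.19 L142–145)] -/
def freqInd (β eps0 : ℝ) : ℝ × ℝ → ℝ≥0∞ :=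
  {z : ℝ × ℝ | |omegaStep β z.2| ≤ epsT eps0 z.1}.indicator 1

/-- The shell indicator `1(|E(𝐤)| ≤ ε_s)` of (5.18) (second line) / the region `𝓡(ε_s)` of (6.1), as an
`ℝ≥0∞`-valued function of `(s, 𝐤)` (proof device). [cite: Salmhofer1998, Lemma 4 (5.18) (p.19 L142–145) and §6.1 (6.1) (p.22 L34–39)] -/
def shellIndE (M : ModelData d) : ℝ × Mom d → ℝ≥0∞ :=
  {z : ℝ × Mom d | |M.E z.2| ≤ epsT M.eps0 z.1}.indicator 1

/-- The majorant `4 ε_s⁻¹ 1(|ω_β(k₀)| ≤ ε_s) 1(|E(𝐤)| ≤ ε_s)` of `|Ḋ̂_s(k)|` ((5.18) at `α = 0`, second line,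
`B₀ = 4`; tree `norm_deriv_cutoffCovInf_le'`), as an `ℝ≥0∞`-valued function (proof device: the integrand of
the scale decomposition `Ĉ_t = -∫_t ds Ċ_s` of an undifferentiated line, p.22 L159–163).
[cite: Salmhofer1998, Lemma 4 (5.18) (p.19 L138–145) and Lemma 7 proof (p.22 L159–163)] -/
def scaleLine (M : ModelData d) (β s : ℝ) (k : FMom d) : ℝ≥0∞ :=
  ENNReal.ofReal (4 * (epsT M.eps0 s)⁻¹) * freqInd β M.eps0 (s, k.1) * shellIndE M (s, k.2)

/-- `(s, k₀) ↦ 1(|ω_β(k₀)| ≤ ε_s)` is measurable (`ω_β` is a step function, `ε_s` continuous).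
[cite: Salmhofer1998, §5.4 (5.13) (p.19 L93–98)] -/
theorem measurable_freqInd (β eps0 : ℝ) : Measurable (freqInd β eps0) := by
  unfold freqInd
  refine measurable_one.indicator (measurableSet_le ?_ ?_)
  · exact ((measurable_omegaStep β).comp measurable_snd).abs
  · unfold epsT; fun_prop

/-- `(s, 𝐤) ↦ 1(|E(𝐤)| ≤ ε_s)` is measurable (`E` continuous). [cite: Salmhofer1998, §6.1 (6.1) (p.22 L34–39)] -/
theorem measurable_shellIndE {M : ModelData d} (hM : M.Hyp) : Measurable (shellIndE M) := by
  unfold shellIndE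
  refine measurable_one.indicator (measurableSet_le ?_ ?_)
  · exact (hM.contDiff_E.continuous.measurable.comp measurable_snd).abs
  · unfold epsT; fun_prop

/-- Joint measurability of `(s, k) ↦ 4ε_s⁻¹ 1(|ω_β(k₀)| ≤ ε_s) 1(|E(𝐤)| ≤ ε_s)`.
[cite: Salmhofer1998, Lemma 4 (5.18) (p.19 L138–145)] -/
theorem measurable_scaleLine {M : ModelData d} (hM : M.Hyp) (β : ℝ) :
    Measurable fun z : ℝ × FMom d => scaleLine M β z.1 z.2 := by
  unfold scaleLine
  have h1 : Measurable fun z : ℝ × FMom d => ENNReal.ofReal (4 * (epsT M.eps0 z.1)⁻¹) := by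
    unfold epsT
    exact ENNReal.measurable_ofReal.comp (by fun_prop)
  have h2 : Measurable fun z : ℝ × FMom d => freqInd β M.eps0 (z.1, z.2.1) :=
    (measurable_freqInd β M.eps0).comp (measurable_fst.prodMk (measurable_fst.comp measurable_snd))
  have h3 : Measurable fun z : ℝ × FMom d => shellIndE M (z.1, z.2.2) :=
    (measurable_shellIndE hM).comp (measurable_fst.prodMk (measurable_snd.comp measurable_snd))
  exact (h1.mul h2).mul h3

/-- Pointwise form of the frequency indicator. [cite: Salmhofer1998, Lemma 4 (5.18) (p.19 L142–145)] -/
theorem freqInd_apply (β eps0 s x : ℝ) :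
    freqInd β eps0 (s, x) = if |omegaStep β x| ≤ epsT eps0 s then 1 else 0 := by
  unfold freqInd
  by_cases h : |omegaStep β x| ≤ epsT eps0 s
  · rw [indicator_of_mem (by exact h), if_pos h]; rfl
  · rw [indicator_of_notMem (by exact h), if_neg h]

/-- Pointwise form of the shell indicator. [cite: Salmhofer1998, Lemma 4 (5.18) (p.19 L142–145)] -/
theorem shellIndE_apply (M : ModelData d) (s : ℝ) (p : Mom d) :
    shellIndE M (s, p) = if |M.E p| ≤ epsT M.eps0 s then 1 else 0 := by
  unfold shellIndE
  by_cases h : |M.E p| ≤ epsT M.eps0 s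
  · rw [indicator_of_mem (by exact h), if_pos h]; rfl
  · rw [indicator_of_notMem (by exact h), if_neg h]

/-- `scaleLine` is the `ℝ≥0∞` form of the real majorant `4ε_s⁻¹ 1(|ω_β(k₀)| ≤ ε_s) 1(|E(𝐤)| ≤ ε_s)` of
`norm_deriv_cutoffCovInf_le'`. [cite: Salmhofer1998, Lemma 4 (5.18) (p.19 L138–145)] -/
theorem scaleLine_eq_ofReal (M : ModelData d) (β s : ℝ) (k : FMom d) :
    scaleLine M β s k = ENNReal.ofReal (4 * (epsT M.eps0 s)⁻¹ *
      ((if |omegaStep β k.1| ≤ epsT M.eps0 s then (1 : ℝ) else 0) *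
        (if |M.E k.2| ≤ epsT M.eps0 s then (1 : ℝ) else 0))) := by
  rw [scaleLine, freqInd_apply, shellIndE_apply]
  split_ifs <;> simp

/-- **The scale decomposition of an undifferentiated line** (p.22 L159–163: "I use `Ċ_t = 0` for
`t > log(βε₀/π)` to write `Ĉ_t(k_j) = -∫_t^{log βε₀} dt_j Ċ_{t_j}(k_j)`", with (5.18) at `α = 0`):
`|D̂_t(k)| ≤ ∫_t^∞ ds 4ε_s⁻¹ 1(|ω_β(k₀)| ≤ ε_s) 1(|E(𝐤)| ≤ ε_s)` (FTC on `[t, T]` with `T > log(βε₀/π)`, tree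
`enorm_cutoffCovInf_le_lintegral`; the bound is extended to `(t, ∞)`, which removes `β` from it).
[cite: Salmhofer1998, Lemma 7 proof (p.22 L159–163)] -/
theorem enorm_modelProp_toMats_le_lintegral_scaleLine {M : ModelData d} (hM : M.Hyp) {χ₁ : ℝ → ℝ}
    (hχ : IsCutoff χ₁) {β : ℝ} (hβ : 0 < β) (t : ℝ) (k : FMom d) :
    ‖modelProp M χ₁ t (toMats β k)‖ₑ ≤ ∫⁻ s in Ioi t, scaleLine M β s k := by
  set T : ℝ := max t (Real.log (β * M.eps0 / Real.pi) + 1) with hTdef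
  have htT : t ≤ T := le_max_left _ _
  have hT : Real.log (β * M.eps0 / Real.pi) < T := lt_of_lt_of_le (lt_add_one _) (le_max_right _ _)
  rw [modelProp_toMats]
  calc ‖cutoffCovInf M χ₁ β t k.1 k.2‖ₑ
      ≤ ∫⁻ s in Ioc t T, ‖deriv (fun s : ℝ => cutoffCovInf M χ₁ β s k.1 k.2) s‖ₑ :=
        enorm_cutoffCovInf_le_lintegral M hχ hM.eps0_pos hβ htT hT k.1 k.2
    _ ≤ ∫⁻ s in Ioc t T, scaleLine M β s k := by
        refine lintegral_mono fun s => ?_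
        rw [scaleLine_eq_ofReal, ← ofReal_norm]
        exact ENNReal.ofReal_le_ofReal (norm_deriv_cutoffCovInf_le' M hχ hM.eps0_pos β s k.1 k.2)
    _ ≤ ∫⁻ s in Ioi t, scaleLine M β s k := lintegral_mono_set Ioc_subset_Ioi_self

/-- The frequency integral of the majorant: `∫_ℝ dk₀ 4ε_s⁻¹ 1(|ω_β(k₀)| ≤ ε_s) ≤ 16`, uniformly in `β`
((5.19′) `M_β ≤ (2/π)ε`, tree `volume_abs_omegaStep_le`; print's "doing the integrals over `(k₁)₀` and `(k₂)₀` …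
by (5.20)", p.22 L160–163). [cite: Salmhofer1998, Lemma 7 proof (p.22 L160–163) and Lemma 4 proof (p.20 L14–22)] -/
theorem lintegral_freq_scaleLine_le {M : ModelData d} (hM : M.Hyp) {β : ℝ} (hβ : 0 < β) (s : ℝ) :
    ∫⁻ x : ℝ, ENNReal.ofReal (4 * (epsT M.eps0 s)⁻¹) * freqInd β M.eps0 (s, x) ≤ 16 := by
  have hε := epsT_pos hM.eps0_pos s
  have hmeas : Measurable fun x : ℝ => freqInd β M.eps0 (s, x) :=
    (measurable_freqInd β M.eps0).comp (measurable_const.prodMk measurable_id)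
  rw [lintegral_const_mul _ hmeas]
  have hset : (fun x : ℝ => freqInd β M.eps0 (s, x)) =
      {x : ℝ | |omegaStep β x| ≤ epsT M.eps0 s}.indicator 1 := by
    funext x
    rw [freqInd_apply]
    by_cases h : |omegaStep β x| ≤ epsT M.eps0 s
    · rw [if_pos h, indicator_of_mem (by exact h)]; rfl
    · rw [if_neg h, indicator_of_notMem (by exact h)]
  rw [hset, lintegral_indicator_one (measurableSet_le (measurable_omegaStep β).abs measurable_const)]
  calc ENNReal.ofReal (4 * (epsT M.eps0 s)⁻¹) * volume {x : ℝ | |omegaStep β x| ≤ epsT M.eps0 s}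
      ≤ ENNReal.ofReal (4 * (epsT M.eps0 s)⁻¹) * ENNReal.ofReal (4 * epsT M.eps0 s) := by
        gcongr
        exact volume_abs_omegaStep_le hβ hε.le
    _ = 16 := by
        rw [← ENNReal.ofReal_mul (by positivity)]
        have : 4 * (epsT M.eps0 s)⁻¹ * (4 * epsT M.eps0 s) = 16 := by field_simp; norm_num
        rw [this]
        norm_num


/-- Volume on the one-line region `ℝ × 𝓑` is the product of Lebesgue measure on `ℝ` (frequency) and the
volume of the Brillouin box (momentum): `∫_{ℝ×𝓑} dk = ∫_ℝ dk₀ ∫_𝓑 d𝐤`. [cite: Salmhofer1998, §5.4 (5.14) (p.19 L100–105)] -/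
theorem volume_restrict_lineSet (d : ℕ) (latt : ℝ) :
    (volume : Measure (FMom d)).restrict ((univ : Set ℝ) ×ˢ bzBox d latt) =
      (volume : Measure ℝ).prod ((volume : Measure (Mom d)).restrict (bzBox d latt)) := by
  rw [Measure.volume_eq_prod, ← Measure.prod_restrict, Measure.restrict_univ]

/-- **Factorisation of the two-line phase-space integral** into the two frequency integrals and the joint
spatial integral (Tonelli; the step "doing the integrals over `(k₁)₀` and `(k₂)₀`", p.22 L160–163).
[cite: Salmhofer1998, Lemma 7 proof (6.10)–(6.11) (p.22 L160–179)] -/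
theorem setLIntegral_twoLine_factor (d : ℕ) (latt : ℝ) {f₁ f₂ : ℝ → ℝ≥0∞} {Ψ : Mom d × Mom d → ℝ≥0∞}
    (hf₁ : Measurable f₁) (hf₂ : Measurable f₂) (hΨ : Measurable Ψ) :
    ∫⁻ p in ((univ : Set ℝ) ×ˢ bzBox d latt) ×ˢ ((univ : Set ℝ) ×ˢ bzBox d latt),
        f₁ p.1.1 * f₂ p.2.1 * Ψ (p.1.2, p.2.2) =
      (∫⁻ x, f₁ x) * (∫⁻ x, f₂ x) * ∫⁻ y in bzBox d latt ×ˢ bzBox d latt, Ψ y := by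
  set B : Set (Mom d) := bzBox d latt with hB
  set S : Set (FMom d) := (univ : Set ℝ) ×ˢ B with hS
  have hSvol : (volume : Measure (FMom d)).restrict S =
      (volume : Measure ℝ).prod ((volume : Measure (Mom d)).restrict B) := volume_restrict_lineSet d latt
  have hSS : (volume : Measure (FMom d × FMom d)).restrict (S ×ˢ S) =
      ((volume : Measure (FMom d)).restrict S).prod ((volume : Measure (FMom d)).restrict S) := by
    rw [Measure.volume_eq_prod, Measure.prod_restrict]
  have hBB : (volume : Measure (Mom d × Mom d)).restrict (B ×ˢ B) =
      ((volume : Measure (Mom d)).restrict B).prod ((volume : Measure (Mom d)).restrict B) := by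
    rw [Measure.volume_eq_prod, Measure.prod_restrict]
  -- the integrand is jointly measurable
  have hF : Measurable fun p : FMom d × FMom d => f₁ p.1.1 * f₂ p.2.1 * Ψ (p.1.2, p.2.2) := by
    have h1 : Measurable fun p : FMom d × FMom d => f₁ p.1.1 := hf₁.comp (measurable_fst.comp measurable_fst)
    have h2 : Measurable fun p : FMom d × FMom d => f₂ p.2.1 := hf₂.comp (measurable_fst.comp measurable_snd)
    have h3 : Measurable fun p : FMom d × FMom d => Ψ (p.1.2, p.2.2) :=
      hΨ.comp ((measurable_snd.comp measurable_fst).prodMk (measurable_snd.comp measurable_snd))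
    exact (h1.mul h2).mul h3
  -- the spatial slice `h(𝐤₀) = ∫_𝓑 Ψ(𝐤₀, 𝐤₁) d𝐤₁` is measurable
  set h : Mom d → ℝ≥0∞ := fun q => ∫⁻ q' in B, Ψ (q, q') with hh
  have hmeas_h : Measurable h := by
    rw [hh]
    exact hΨ.lintegral_prod_right'
  -- inner integral over the second line
  have hinner : ∀ k₀ : FMom d,
      ∫⁻ k₁, f₁ k₀.1 * f₂ k₁.1 * Ψ (k₀.2, k₁.2) ∂((volume : Measure (FMom d)).restrict S) =
        f₁ k₀.1 * ((∫⁻ x, f₂ x) * h k₀.2) := by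
    intro k₀
    have hm : Measurable fun k₁ : FMom d => f₂ k₁.1 * Ψ (k₀.2, k₁.2) :=
      (hf₂.comp measurable_fst).mul (hΨ.comp (measurable_const.prodMk measurable_snd))
    simp_rw [mul_assoc]
    rw [lintegral_const_mul _ hm, hSvol]
    have key := lintegral_prod_mul (μ := (volume : Measure ℝ)) (ν := (volume : Measure (Mom d)).restrict B)
      (f := f₂) (g := fun y : Mom d => Ψ (k₀.2, y)) hf₂.aemeasurable
      (hΨ.comp (measurable_const.prodMk measurable_id)).aemeasurable
    rw [key]
  rw [hSS, lintegral_prod _ hF.aemeasurable]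
  simp_rw [hinner]
  rw [hSvol, lintegral_prod_mul hf₁.aemeasurable ((hmeas_h.const_mul _).aemeasurable),
    lintegral_const_mul _ hmeas_h, hh, hBB, lintegral_prod _ hΨ.aemeasurable]
  ring

/-- **Print's region (6.11)**: the two-shell phase-space region
`{(𝐤₁, 𝐤₂) ∈ 𝓡(ε₁) × 𝓡(ε₂) : |E(v₁𝐤₁ + v₂𝐤₂ + 𝐪)| ≤ ε}` (momenta in the Brillouin box `𝓑`), whose Lebesgue
volume is `𝒱(t, t₁, t₂)` at `ε = ε_t`, `ε_j = ε_{t_j}`. [cite: Salmhofer1998, Lemma 7 proof (6.11) (p.22 L173–178)] -/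
def twoShellSet (M : ModelData d) (ε₁ ε₂ ε : ℝ) (v₁ v₂ : Bool) (q : Mom d) : Set (Mom d × Mom d) :=
  (bzBox d M.latt ×ˢ bzBox d M.latt) ∩
    {y | |M.E y.1| ≤ ε₁ ∧ |M.E y.2| ≤ ε₂ ∧
      |M.E ((if v₁ then (1 : ℝ) else -1) • y.1 + (if v₂ then (1 : ℝ) else -1) • y.2 + q)| ≤ ε}

/-- **The two-shell volume bound — Lemma 6 read through the low-energy chart** (print (6.11)–(6.12) with
Lemma 6 inserted: "`𝒱(t,t₁,t₂) ≤ (2ε₀J₀)² e^{-t₁-t₂} 𝓦((1 + 4|E|₁/g₀) ε₀e^{-t})`" and "`𝓦(ε) ≤ Q_V ε (1+|log ε|)`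
(`d = 2`), `Q_V ε` (`d ≥ 3`)", p.22 L174 – p.23 L21 and Lemma 6 p.22 L46–62): `V ≥ 0` and for all
transfers `𝐪`, signs `v₁, v₂` and scales `0 < ε₁, ε₂ ≤ ε ≤ ε₀`,
`vol{(𝐤₁,𝐤₂) ∈ 𝓑² : |E(𝐤₁)| ≤ ε₁, |E(𝐤₂)| ≤ ε₂, |E(v₁𝐤₁ + v₂𝐤₂ + 𝐪)| ≤ ε} ≤ V ε₁ ε₂ ε (1 + δ_{d,2}|log ε|)`.
A `Prop`-valued predicate on the model datum and the constant (never asserted): the phase-space geometry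
input of (6.9), for the many-fermion class the content of Lemma 6 (= [FST2] Theorem 1.1, tree
`FermiRG.VolumeBound`) and of the coordinates `(ρ, θ)` of §2.3 with Jacobian `J ≤ J₀` (p.22 L179–190).
[cite: Salmhofer1998, Lemma 6 (p.22 L46–62) and Lemma 7 proof (6.11)–(6.12) (p.22 L174 – p.23 L21)] -/
def TwoShellVolumeBound (M : ModelData d) (V : ℝ) : Prop :=
  0 ≤ V ∧ ∀ (q : Mom d) (v₁ v₂ : Bool) (ε ε₁ ε₂ : ℝ),
    0 < ε₁ → ε₁ ≤ ε → 0 < ε₂ → ε₂ ≤ ε → ε ≤ M.eps0 →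
      volume (twoShellSet M ε₁ ε₂ ε v₁ v₂ q) ≤
        ENNReal.ofReal (V * ε₁ * ε₂ * (ε * (1 + (deltaTwo d : ℝ) * |Real.log ε|)))

/-- The region (6.11) is Borel (`E` continuous). [cite: Salmhofer1998, Lemma 7 proof (6.11) (p.22 L173–178)] -/
theorem measurableSet_twoShellSet {M : ModelData d} (hM : M.Hyp) (ε₁ ε₂ ε : ℝ) (v₁ v₂ : Bool) (q : Mom d) :
    MeasurableSet (twoShellSet M ε₁ ε₂ ε v₁ v₂ q) := by
  have hE : Measurable M.E := hM.contDiff_E.continuous.measurable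
  unfold twoShellSet
  simp only [Set.setOf_and]
  refine ((measurableSet_bzBox d M.latt).prod (measurableSet_bzBox d M.latt)).inter ?_
  refine (measurableSet_le (hE.comp measurable_fst).abs measurable_const).inter
    ((measurableSet_le (hE.comp measurable_snd).abs measurable_const).inter
      (measurableSet_le ?_ measurable_const))
  exact (hE.comp (((measurable_fst.const_smul (if v₁ then (1 : ℝ) else -1)).add
    (measurable_snd.const_smul (if v₂ then (1 : ℝ) else -1))).add_const _)).abs


/-- The frequency volume `∫_ℝ dk₀ 1(|ω_β(k₀)| ≤ ε_s) ≤ 4ε_s`, uniformly in `β` ((5.19′); tree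
`volume_abs_omegaStep_le`). [cite: Salmhofer1998, Lemma 4 proof (5.19′) (p.20 L14–22)] -/
theorem lintegral_freqInd_le {eps0 β : ℝ} (h0 : 0 < eps0) (hβ : 0 < β) (s : ℝ) :
    ∫⁻ x : ℝ, freqInd β eps0 (s, x) ≤ ENNReal.ofReal (4 * epsT eps0 s) := by
  have hset : (fun x : ℝ => freqInd β eps0 (s, x)) = {x : ℝ | |omegaStep β x| ≤ epsT eps0 s}.indicator 1 := by
    funext x
    rw [freqInd_apply]
    by_cases h : |omegaStep β x| ≤ epsT eps0 s
    · rw [if_pos h, indicator_of_mem (by exact h)]; rfl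
    · rw [if_neg h, indicator_of_notMem (by exact h)]
  rw [hset, lintegral_indicator_one (measurableSet_le (measurable_omegaStep β).abs measurable_const)]
  exact volume_abs_omegaStep_le hβ (epsT_pos h0 s).le

/-- `∫_t^∞ ε_s ds = ε_t` as a Lebesgue integral ("The integrals over `t₁` and `t₂` give" (6.13), p.23 L23–28:
`∫_t^∞ e^{-t_j} dt_j = e^{-t}`). [cite: Salmhofer1998, Lemma 7 proof (6.13) (p.23 L23–28)] -/
theorem lintegral_Ioi_epsT {eps0 : ℝ} (h0 : 0 ≤ eps0) (t : ℝ) :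
    ∫⁻ s in Ioi t, ENNReal.ofReal (epsT eps0 s) = ENNReal.ofReal (epsT eps0 t) := by
  have hint : IntegrableOn (fun s : ℝ => epsT eps0 s) (Ioi t) := by
    unfold epsT
    exact (integrableOn_exp_neg_Ioi t).const_mul eps0
  have hnn : 0 ≤ᵐ[volume.restrict (Ioi t)] fun s : ℝ => epsT eps0 s :=
    Filter.Eventually.of_forall fun s => mul_nonneg h0 (Real.exp_pos _).le
  rw [← ofReal_integral_eq_lintegral_ofReal hint hnn]
  congr 1
  unfold epsT
  rw [MeasureTheory.integral_const_mul, integral_exp_neg_Ioi]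

/-- The constraint set `{(𝐤₁,𝐤₂) : |E(v₁𝐤₁ + v₂𝐤₂ + 𝐪)| ≤ ε}` of the differentiated line `Ċ_t` in
(6.10)–(6.11) (signs `v_j = ±1` as reals `c_j`). [cite: Salmhofer1998, Lemma 7 proof (6.10)–(6.11) (p.22 L160–178)] -/
def pairShell (M : ModelData d) (ε c₁ c₂ : ℝ) (q : Mom d) : Set (Mom d × Mom d) :=
  {y | |M.E (c₁ • y.1 + c₂ • y.2 + q)| ≤ ε}

/-- The constraint set is Borel (`E` continuous). [cite: Salmhofer1998, Lemma 7 proof (6.11) (p.22 L173–178)] -/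
theorem measurableSet_pairShell {M : ModelData d} (hM : M.Hyp) (ε c₁ c₂ : ℝ) (q : Mom d) :
    MeasurableSet (pairShell M ε c₁ c₂ q) :=
  measurableSet_le ((hM.contDiff_E.continuous.measurable).comp (((measurable_fst.const_smul c₁).add
    (measurable_snd.const_smul c₂)).add_const _)).abs measurable_const

/-- The two shell indicators and the constraint indicator multiply to the indicator of print's region (6.11)
`{𝐤₁ ∈ 𝓡(ε_{s₁}), 𝐤₂ ∈ 𝓡(ε_{s₂}), |E(v₁𝐤₁ + v₂𝐤₂ + 𝐪)| ≤ ε}`. [cite: Salmhofer1998, Lemma 7 proof (6.11) (p.22 L173–178)] -/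
theorem shellIndE_mul_eq_indicator (M : ModelData d) (s₁ s₂ ε c₁ c₂ : ℝ) (q : Mom d)
    (y : Mom d × Mom d) :
    shellIndE M (s₁, y.1) * shellIndE M (s₂, y.2) * (pairShell M ε c₁ c₂ q).indicator 1 y =
      {y : Mom d × Mom d | |M.E y.1| ≤ epsT M.eps0 s₁ ∧ |M.E y.2| ≤ epsT M.eps0 s₂ ∧
        |M.E (c₁ • y.1 + c₂ • y.2 + q)| ≤ ε}.indicator 1 y := by
  rw [shellIndE_apply, shellIndE_apply]
  by_cases h1 : |M.E y.1| ≤ epsT M.eps0 s₁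
  · by_cases h2 : |M.E y.2| ≤ epsT M.eps0 s₂
    · by_cases h3 : |M.E (c₁ • y.1 + c₂ • y.2 + q)| ≤ ε
      · rw [if_pos h1, if_pos h2, indicator_of_mem (show y ∈ pairShell M ε c₁ c₂ q from h3),
          indicator_of_mem (show y ∈ {y : Mom d × Mom d | |M.E y.1| ≤ epsT M.eps0 s₁ ∧
            |M.E y.2| ≤ epsT M.eps0 s₂ ∧ |M.E (c₁ • y.1 + c₂ • y.2 + q)| ≤ ε} from ⟨h1, h2, h3⟩)]
        simp
      · rw [indicator_of_notMem (show y ∉ pairShell M ε c₁ c₂ q from h3),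
          indicator_of_notMem (show y ∉ {y : Mom d × Mom d | |M.E y.1| ≤ epsT M.eps0 s₁ ∧
            |M.E y.2| ≤ epsT M.eps0 s₂ ∧ |M.E (c₁ • y.1 + c₂ • y.2 + q)| ≤ ε} from fun h => h3 h.2.2)]
        simp
    · rw [if_neg h2, indicator_of_notMem (show y ∉ {y : Mom d × Mom d | |M.E y.1| ≤ epsT M.eps0 s₁ ∧
        |M.E y.2| ≤ epsT M.eps0 s₂ ∧ |M.E (c₁ • y.1 + c₂ • y.2 + q)| ≤ ε} from fun h => h2 h.2.1)]
      simp
  · rw [if_neg h1, indicator_of_notMem (show y ∉ {y : Mom d × Mom d | |M.E y.1| ≤ epsT M.eps0 s₁ ∧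
      |M.E y.2| ≤ epsT M.eps0 s₂ ∧ |M.E (c₁ • y.1 + c₂ • y.2 + q)| ≤ ε} from fun h => h1 h.1)]
    simp

/-- The integrand of print's `∫dt₁∫dt₂ 𝒱(t,t₁,t₂)` before the phase-space integration: the two scale-decomposed
lines at scales `(s₁, s₂) = σ` times the constraint indicator, as a function of `((k₁,k₂), (s₁,s₂))`.
[cite: Salmhofer1998, Lemma 7 proof (6.10)–(6.11) (p.22 L160–178)] -/
def scalePair (M : ModelData d) (β ε c₁ c₂ : ℝ) (q : Mom d) (z : (FMom d × FMom d) × (ℝ × ℝ)) : ℝ≥0∞ :=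
  ENNReal.ofReal (loopWeight d 1 ^ 2) * (scaleLine M β z.2.1 z.1.1 * scaleLine M β z.2.2 z.1.2) *
    (pairShell M ε c₁ c₂ q).indicator 1 (z.1.1.2, z.1.2.2)

/-- Joint measurability of the integrand `scalePair` in `((k₁,k₂),(s₁,s₂))` (needed for Tonelli).
[cite: Salmhofer1998, Lemma 7 proof (6.10)–(6.11) (p.22 L160–178)] -/
theorem measurable_scalePair {M : ModelData d} (hM : M.Hyp) (β ε c₁ c₂ : ℝ) (q : Mom d) :
    Measurable (scalePair M β ε c₁ c₂ q) := by
  have hπ₁ : Measurable fun z : (FMom d × FMom d) × (ℝ × ℝ) => (z.2.1, z.1.1) :=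
    (measurable_fst.comp measurable_snd).prodMk (measurable_fst.comp measurable_fst)
  have hπ₂ : Measurable fun z : (FMom d × FMom d) × (ℝ × ℝ) => (z.2.2, z.1.2) :=
    (measurable_snd.comp measurable_snd).prodMk (measurable_snd.comp measurable_fst)
  have hπ₃ : Measurable fun z : (FMom d × FMom d) × (ℝ × ℝ) => (z.1.1.2, z.1.2.2) :=
    (measurable_snd.comp (measurable_fst.comp measurable_fst)).prodMk
      (measurable_snd.comp (measurable_snd.comp measurable_fst))
  -- (composition lemmas are elaborated WITHOUT an expected type and then assigned: avoids higher-order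
  -- unification through the definitions)
  have h1' := (measurable_scaleLine hM β).comp hπ₁
  have h1 : Measurable fun z : (FMom d × FMom d) × (ℝ × ℝ) => scaleLine M β z.2.1 z.1.1 := h1'
  have h2' := (measurable_scaleLine hM β).comp hπ₂
  have h2 : Measurable fun z : (FMom d × FMom d) × (ℝ × ℝ) => scaleLine M β z.2.2 z.1.2 := h2'
  have h1ind : Measurable ((pairShell M ε c₁ c₂ q).indicator (1 : Mom d × Mom d → ℝ≥0∞)) :=
    measurable_one.indicator (measurableSet_pairShell hM ε c₁ c₂ q)
  have h3' := h1ind.comp hπ₃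
  have h3 : Measurable fun z : (FMom d × FMom d) × (ℝ × ℝ) =>
      ((pairShell M ε c₁ c₂ q).indicator 1 (z.1.1.2, z.1.2.2) : ℝ≥0∞) := h3'
  have h4 : Measurable fun z : (FMom d × FMom d) × (ℝ × ℝ) =>
      (ENNReal.ofReal (loopWeight d 1 ^ 2) * (scaleLine M β z.2.1 z.1.1 * scaleLine M β z.2.2 z.1.2) *
        (pairShell M ε c₁ c₂ q).indicator 1 (z.1.1.2, z.1.2.2) : ℝ≥0∞) :=
    ((h1.mul h2).const_mul _).mul h3
  unfold scalePair
  exact h4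

/-- Commutative rearrangement of the factors of (6.10) (stated on opaque atoms so that no integral is
unfolded by unification). [cite: Salmhofer1998, Lemma 7 proof (6.10) (p.22 L160–170)] -/
theorem mul_rearrange₁ (w i A B : ℝ≥0∞) : w * w * i * (A * B) = w * A * (w * B) * i := by ring

/-- Commutative rearrangement of the factors of (6.10) (opaque atoms).
[cite: Salmhofer1998, Lemma 7 proof (6.10) (p.22 L160–170)] -/
theorem mul_rearrange₂ (w A B b i : ℝ≥0∞) : w * w * (A * B) * (b * i) = b * (w * A * (w * B) * i) := by ring

/-- The product of the two scale-decomposed lines times the constraint is the `(s₁,s₂)`-integral of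
`scalePair` (Tonelli for a product). [cite: Salmhofer1998, Lemma 7 proof (6.10) (p.22 L160–170)] -/
theorem lineMajorants_mul_eq_lintegral_scalePair {M : ModelData d} (hM : M.Hyp) (β ε c₁ c₂ : ℝ)
    (q : Mom d) (t : ℝ) (p : FMom d × FMom d) :
    (ENNReal.ofReal (loopWeight d 1) * ∫⁻ s in Ioi t, scaleLine M β s p.1) *
        (ENNReal.ofReal (loopWeight d 1) * ∫⁻ s in Ioi t, scaleLine M β s p.2) *
          (pairShell M ε c₁ c₂ q).indicator 1 (p.1.2, p.2.2) =
      ∫⁻ σ in Ioi t ×ˢ Ioi t, scalePair M β ε c₁ c₂ q (p, σ) := by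
  have hsl : ∀ k : FMom d, Measurable fun s : ℝ => scaleLine M β s k := fun k => by
    have hf : Measurable fun s : ℝ => (s, k) := measurable_id.prodMk measurable_const
    have h := (measurable_scaleLine hM β).comp hf
    exact h
  have hm₁ := (hsl p.1).comp (measurable_fst : Measurable fun σ : ℝ × ℝ => σ.1)
  have hm₂ := (hsl p.2).comp (measurable_snd : Measurable fun σ : ℝ × ℝ => σ.2)
  have hm : Measurable fun σ : ℝ × ℝ => scaleLine M β σ.1 p.1 * scaleLine M β σ.2 p.2 := hm₁.mul hm₂
  have hII : (volume : Measure (ℝ × ℝ)).restrict (Ioi t ×ˢ Ioi t) =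
      ((volume : Measure ℝ).restrict (Ioi t)).prod ((volume : Measure ℝ).restrict (Ioi t)) := by
    rw [Measure.volume_eq_prod, Measure.prod_restrict]
  symm
  calc ∫⁻ σ in Ioi t ×ˢ Ioi t, scalePair M β ε c₁ c₂ q (p, σ)
      = ∫⁻ σ in Ioi t ×ˢ Ioi t, (ENNReal.ofReal (loopWeight d 1 ^ 2) *
          (pairShell M ε c₁ c₂ q).indicator 1 (p.1.2, p.2.2)) * (scaleLine M β σ.1 p.1 * scaleLine M β σ.2 p.2) := by
        refine lintegral_congr fun σ => ?_
        simp only [scalePair]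
        ring
    _ = (ENNReal.ofReal (loopWeight d 1 ^ 2) * (pairShell M ε c₁ c₂ q).indicator 1 (p.1.2, p.2.2)) *
          ((∫⁻ s in Ioi t, scaleLine M β s p.1) * (∫⁻ s in Ioi t, scaleLine M β s p.2)) := by
        rw [lintegral_const_mul _ hm, hII, lintegral_prod_mul (hsl p.1).aemeasurable (hsl p.2).aemeasurable]
    _ = _ := by
        rw [pow_two, ENNReal.ofReal_mul (loopWeight_nonneg d 1)]
        exact mul_rearrange₁ _ _ _ _

/-- `∏ ofReal = ofReal ∏` for the six nonnegative constants of (6.12) in the grouping used below.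
[cite: Salmhofer1998, Lemma 7 proof (6.12) (p.23 L16–21)] -/
theorem ofReal_mul₆ {a b c d e f : ℝ} (ha : 0 ≤ a) (hb : 0 ≤ b) (hc : 0 ≤ c) (hd : 0 ≤ d)
    (he : 0 ≤ e) :
    ENNReal.ofReal a * ENNReal.ofReal b * ENNReal.ofReal c *
        (ENNReal.ofReal d * ENNReal.ofReal e * ENNReal.ofReal f) =
      ENNReal.ofReal (a * b * c * (d * e * f)) := by
  rw [← ENNReal.ofReal_mul ha, ← ENNReal.ofReal_mul (mul_nonneg ha hb), ← ENNReal.ofReal_mul hd,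
    ← ENNReal.ofReal_mul (mul_nonneg hd he), ← ENNReal.ofReal_mul (mul_nonneg (mul_nonneg ha hb) hc)]

/-- **(6.11)–(6.12) with Lemma 6, at fixed scales**: for `t < s₁, s₂` (`t ≥ 0`) the phase-space integral of
`scalePair` is `w₁² · 4ε_{s₁}⁻¹ · 4ε_{s₂}⁻¹ ·` (frequency volumes `≤ 4ε_{s₁} · 4ε_{s₂}`) `·` (two-shell volume
`≤ V ε_{s₁} ε_{s₂} ε_t (1 + δ_{d,2}|log ε_t|)`), i.e. `≤ 256 w₁² V ε_t (1+δ_{d,2}|log ε_t|) ε_{s₁} ε_{s₂}` — print's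
"`𝒱(t,t₁,t₂) ≤ (2ε₀J₀)² e^{-t₁-t₂} 𝓦(…)`". [cite: Salmhofer1998, Lemma 7 proof (6.11)–(6.12) (p.22 L174 – p.23 L21)] -/
theorem setLIntegral_scalePair_le {M : ModelData d} (hM : M.Hyp) {V : ℝ} (hV : TwoShellVolumeBound M V)
    {β : ℝ} (hβ : 0 < β) {t : ℝ} (ht : 0 ≤ t) {s₁ s₂ : ℝ} (hs₁ : t < s₁) (hs₂ : t < s₂)
    (v₁ v₂ : Bool) (q : Mom d) :
    ∫⁻ p in ((univ : Set ℝ) ×ˢ bzBox d M.latt) ×ˢ ((univ : Set ℝ) ×ˢ bzBox d M.latt),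
        scalePair M β (epsT M.eps0 t) (if v₁ then (1 : ℝ) else -1) (if v₂ then (1 : ℝ) else -1) q
          (p, (s₁, s₂)) ≤
      ENNReal.ofReal (256 * loopWeight d 1 ^ 2 * V *
        (epsT M.eps0 t * (1 + (deltaTwo d : ℝ) * |Real.log (epsT M.eps0 t)|)) *
          (epsT M.eps0 s₁ * epsT M.eps0 s₂)) := by
  have hE : Measurable M.E := hM.contDiff_E.continuous.measurable
  have hε := epsT_pos hM.eps0_pos t
  have hε₁ := epsT_pos hM.eps0_pos s₁
  have hε₂ := epsT_pos hM.eps0_pos s₂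
  have hε₁t : epsT M.eps0 s₁ ≤ epsT M.eps0 t := epsT_le_epsT_of_le hM.eps0_pos.le hs₁.le
  have hε₂t : epsT M.eps0 s₂ ≤ epsT M.eps0 t := epsT_le_epsT_of_le hM.eps0_pos.le hs₂.le
  have hεε₀ : epsT M.eps0 t ≤ M.eps0 := epsT_le hM.eps0_pos.le ht
  have hℓ0 : 0 ≤ 1 + (deltaTwo d : ℝ) * |Real.log (epsT M.eps0 t)| := by positivity
  set c₁ : ℝ := if v₁ then (1 : ℝ) else -1 with hc₁
  set c₂ : ℝ := if v₂ then (1 : ℝ) else -1 with hc₂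
  -- the spatial integrand and its identification with the indicator of (6.11)
  set Ψ : Mom d × Mom d → ℝ≥0∞ := fun y =>
    shellIndE M (s₁, y.1) * shellIndE M (s₂, y.2) * (pairShell M (epsT M.eps0 t) c₁ c₂ q).indicator 1 y
    with hΨdef
  have hΨm : Measurable Ψ :=
    (((measurable_shellIndE hM).comp (measurable_const.prodMk measurable_fst)).mul
      ((measurable_shellIndE hM).comp (measurable_const.prodMk measurable_snd))).mul
      (measurable_one.indicator (measurableSet_pairShell hM _ c₁ c₂ q))
  have hf₁ : Measurable fun x : ℝ => freqInd β M.eps0 (s₁, x) :=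
    (measurable_freqInd β M.eps0).comp (measurable_const.prodMk measurable_id)
  have hf₂ : Measurable fun x : ℝ => freqInd β M.eps0 (s₂, x) :=
    (measurable_freqInd β M.eps0).comp (measurable_const.prodMk measurable_id)
  have hfac : ∀ p : FMom d × FMom d, scalePair M β (epsT M.eps0 t) c₁ c₂ q (p, (s₁, s₂)) =
      (ENNReal.ofReal (loopWeight d 1 ^ 2) * ENNReal.ofReal (4 * (epsT M.eps0 s₁)⁻¹) *
        ENNReal.ofReal (4 * (epsT M.eps0 s₂)⁻¹)) *
        (freqInd β M.eps0 (s₁, p.1.1) * freqInd β M.eps0 (s₂, p.2.1) * Ψ (p.1.2, p.2.2)) := by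
    intro p
    rw [hΨdef]
    simp only [scalePair, scaleLine]
    ring
  have hmeasF : Measurable fun p : FMom d × FMom d =>
      freqInd β M.eps0 (s₁, p.1.1) * freqInd β M.eps0 (s₂, p.2.1) * Ψ (p.1.2, p.2.2) := by
    have hπ₃ : Measurable fun p : FMom d × FMom d => (p.1.2, p.2.2) :=
      (measurable_snd.comp measurable_fst).prodMk (measurable_snd.comp measurable_snd)
    exact ((hf₁.comp (measurable_fst.comp measurable_fst)).mul
      (hf₂.comp (measurable_fst.comp measurable_snd))).mul (hΨm.comp hπ₃)
  have hWset : MeasurableSet {y : Mom d × Mom d | |M.E y.1| ≤ epsT M.eps0 s₁ ∧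
      |M.E y.2| ≤ epsT M.eps0 s₂ ∧ |M.E (c₁ • y.1 + c₂ • y.2 + q)| ≤ epsT M.eps0 t} := by
    simp only [Set.setOf_and]
    exact (measurableSet_le (hE.comp measurable_fst).abs measurable_const).inter
      ((measurableSet_le (hE.comp measurable_snd).abs measurable_const).inter
        (measurableSet_pairShell hM _ c₁ c₂ q))
  have hvol : ∫⁻ y in bzBox d M.latt ×ˢ bzBox d M.latt, Ψ y =
      volume (twoShellSet M (epsT M.eps0 s₁) (epsT M.eps0 s₂) (epsT M.eps0 t) v₁ v₂ q) := by
    have hΨW : ∀ y, Ψ y = ({y : Mom d × Mom d | |M.E y.1| ≤ epsT M.eps0 s₁ ∧ |M.E y.2| ≤ epsT M.eps0 s₂ ∧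
        |M.E (c₁ • y.1 + c₂ • y.2 + q)| ≤ epsT M.eps0 t}).indicator 1 y := fun y =>
      shellIndE_mul_eq_indicator M s₁ s₂ _ c₁ c₂ q y
    simp_rw [hΨW]
    rw [lintegral_indicator_one hWset, Measure.restrict_apply hWset, twoShellSet, Set.inter_comm]
  calc ∫⁻ p in ((univ : Set ℝ) ×ˢ bzBox d M.latt) ×ˢ ((univ : Set ℝ) ×ˢ bzBox d M.latt),
          scalePair M β (epsT M.eps0 t) c₁ c₂ q (p, (s₁, s₂))
      = (ENNReal.ofReal (loopWeight d 1 ^ 2) * ENNReal.ofReal (4 * (epsT M.eps0 s₁)⁻¹) *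
          ENNReal.ofReal (4 * (epsT M.eps0 s₂)⁻¹)) *
          ((∫⁻ x, freqInd β M.eps0 (s₁, x)) * (∫⁻ x, freqInd β M.eps0 (s₂, x)) *
            volume (twoShellSet M (epsT M.eps0 s₁) (epsT M.eps0 s₂) (epsT M.eps0 t) v₁ v₂ q)) := by
        simp_rw [hfac]
        rw [lintegral_const_mul _ hmeasF, setLIntegral_twoLine_factor d M.latt hf₁ hf₂ hΨm, hvol]
    _ ≤ (ENNReal.ofReal (loopWeight d 1 ^ 2) * ENNReal.ofReal (4 * (epsT M.eps0 s₁)⁻¹) *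
          ENNReal.ofReal (4 * (epsT M.eps0 s₂)⁻¹)) *
          (ENNReal.ofReal (4 * epsT M.eps0 s₁) * ENNReal.ofReal (4 * epsT M.eps0 s₂) *
            ENNReal.ofReal (V * epsT M.eps0 s₁ * epsT M.eps0 s₂ *
              (epsT M.eps0 t * (1 + (deltaTwo d : ℝ) * |Real.log (epsT M.eps0 t)|)))) := by
        gcongr
        · exact lintegral_freqInd_le hM.eps0_pos hβ s₁
        · exact lintegral_freqInd_le hM.eps0_pos hβ s₂
        · exact hV.2 q v₁ v₂ _ _ _ hε₁ hε₁t hε₂ hε₂t hεε₀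
    _ = ENNReal.ofReal (256 * loopWeight d 1 ^ 2 * V *
          (epsT M.eps0 t * (1 + (deltaTwo d : ℝ) * |Real.log (epsT M.eps0 t)|)) *
            (epsT M.eps0 s₁ * epsT M.eps0 s₂)) := by
        rw [ofReal_mul₆ (by positivity) (by positivity) (by positivity) (by positivity) (by positivity)]
        congr 1
        field_simp
        ring

/-- The scale integrals: `∫_{(t,∞)²} K ε_{s₁} ε_{s₂} ds₁ ds₂ = K ε_t²` ("The integrals over `t₁` and `t₂` give …",
(6.13)). [cite: Salmhofer1998, Lemma 7 proof (6.13) (p.23 L23–28)] -/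
theorem lintegral_scales_eq {eps0 : ℝ} (h0 : 0 < eps0) {K : ℝ} (hK : 0 ≤ K) (t : ℝ) :
    ∫⁻ σ in Ioi t ×ˢ Ioi t, ENNReal.ofReal (K * (epsT eps0 σ.1 * epsT eps0 σ.2)) =
      ENNReal.ofReal (K * epsT eps0 t ^ 2) := by
  have hme : Measurable fun s : ℝ => ENNReal.ofReal (epsT eps0 s) := by
    unfold epsT; exact ENNReal.measurable_ofReal.comp (by fun_prop)
  have hfun : (fun σ : ℝ × ℝ => ENNReal.ofReal (K * (epsT eps0 σ.1 * epsT eps0 σ.2))) =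
      fun σ => ENNReal.ofReal K * (ENNReal.ofReal (epsT eps0 σ.1) * ENNReal.ofReal (epsT eps0 σ.2)) := by
    funext σ
    rw [← ENNReal.ofReal_mul (epsT_pos h0 _).le, ← ENNReal.ofReal_mul hK]
  have hII : (volume : Measure (ℝ × ℝ)).restrict (Ioi t ×ˢ Ioi t) =
      ((volume : Measure ℝ).restrict (Ioi t)).prod ((volume : Measure ℝ).restrict (Ioi t)) := by
    rw [Measure.volume_eq_prod, Measure.prod_restrict]
  have hme2 : Measurable fun σ : ℝ × ℝ => ENNReal.ofReal (epsT eps0 σ.1) * ENNReal.ofReal (epsT eps0 σ.2) :=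
    (hme.comp measurable_fst).mul (hme.comp measurable_snd)
  rw [hfun, lintegral_const_mul _ hme2, hII, lintegral_prod_mul hme.aemeasurable hme.aemeasurable,
    lintegral_Ioi_epsT h0.le, ← ENNReal.ofReal_mul (epsT_pos h0 t).le, ← ENNReal.ofReal_mul hK, pow_two]

/-- **(6.10)–(6.13) for the many-fermion propagator: the two overlapping lines.**  For `t ≥ 0`, `β > 0`, a
multi-index `α` with the pointwise bound `|D^α Ċ_t(x,𝐩)| ≤ b·1(|x| ≤ ε_t)1(|E(𝐩)| ≤ ε_t)` ((5.18)) and the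
two-shell volume bound with constant `V`:
`Y_{α,3}(t) ≤ b · 256 w₁² V ε_t³ (1 + δ_{d,2}|log ε_t|)` (`w₁ = (2π)^{-(d+1)}`), i.e. print's
"`Y_α(t,Q,v₁,v₂) ≤ 8² B_α ε_t^{-1-|α|} ∫dt₁∫dt₂ 𝒱(t,t₁,t₂)`" (p.22 L165–170) followed by (6.12)–(6.13) and the
`t₁, t₂`-integrals. [cite: Salmhofer1998, Lemma 7 proof (6.10)–(6.13) (p.22 L143 – p.23 L28)] -/
theorem loopY_two_modelProp_le {M : ModelData d} (hM : M.Hyp) {χ₁ : ℝ → ℝ} (hχ : IsCutoff χ₁)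
    {V : ℝ} (hV : TwoShellVolumeBound M V) {β : ℝ} (hβ : 0 < β) {t : ℝ} (ht : 0 ≤ t)
    {α : Fin d → ℕ} {b : ℝ} (hb : 0 ≤ b)
    (h518t : ∀ (x : ℝ) (p : Mom d), ‖multiMomPartial α (modelPropDot M χ₁ t) (x, p)‖ ≤
        b * (if |x| ≤ epsT M.eps0 t then (1 : ℝ) else 0) * (if |M.E p| ≤ epsT M.eps0 t then (1 : ℝ) else 0)) :
    loopY M.latt β (modelProp M χ₁) (modelPropDot M χ₁) α 2 t ≤
      ENNReal.ofReal (b * (256 * loopWeight d 1 ^ 2 * V *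
        (epsT M.eps0 t ^ 3 * (1 + (deltaTwo d : ℝ) * |Real.log (epsT M.eps0 t)|)))) := by
  classical
  have hε := epsT_pos hM.eps0_pos t
  have hw₁0 : 0 ≤ loopWeight d 1 := loopWeight_nonneg d 1
  have hℓ0 : 0 ≤ 1 + (deltaTwo d : ℝ) * |Real.log (epsT M.eps0 t)| := by positivity
  rw [loopY_eq_iSup]
  refine iSup_le fun Q => iSup_le fun v => ?_
  -- Step 1: the two-line integral as an integral over `(ℝ × 𝓑) × (ℝ × 𝓑)`
  have hset : loopSet d M.latt 2 = MeasurableEquiv.finTwoArrow ⁻¹'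
      (((univ : Set ℝ) ×ˢ bzBox d M.latt) ×ˢ ((univ : Set ℝ) ×ˢ bzBox d M.latt)) := by
    ext k
    rw [Set.mem_preimage, MeasurableEquiv.finTwoArrow_apply]
    simp only [loopSet, Set.mem_pi, Set.mem_univ, true_implies, Fin.forall_fin_two, Set.mem_prod]
  obtain ⟨H, hHdef⟩ : ∃ H : FMom d × FMom d → ℝ≥0∞, H = fun p =>
      ENNReal.ofReal (loopWeight d 2) *
          (‖modelProp M χ₁ t (toMats β p.1)‖ₑ * ‖modelProp M χ₁ t (toMats β p.2)‖ₑ) *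
        ‖multiMomPartial α (modelPropDot M χ₁ t)
          (((if v 0 then (1 : ℝ) else -1) • toMats β p.1 + (if v 1 then (1 : ℝ) else -1) • toMats β p.2) + Q)‖ₑ :=
    ⟨_, rfl⟩
  have hstep1 : ∫⁻ k in loopSet d M.latt 2,
      ENNReal.ofReal (loopWeight d 2) * (∏ j, ‖modelProp M χ₁ t (toMats β (k j))‖ₑ) *
        ‖multiMomPartial α (modelPropDot M χ₁ t)
          ((∑ j, (if v j then (1 : ℝ) else -1) • toMats β (k j)) + Q)‖ₑ =
      ∫⁻ p in ((univ : Set ℝ) ×ˢ bzBox d M.latt) ×ˢ ((univ : Set ℝ) ×ˢ bzBox d M.latt), H p := by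
    rw [hset, ← (volume_preserving_finTwoArrow (FMom d)).setLIntegral_comp_preimage_emb
      (MeasurableEquiv.measurableEmbedding _) H]
    congr 1
    funext k
    rw [MeasurableEquiv.finTwoArrow_apply, hHdef]
    simp only [Fin.prod_univ_two, Fin.sum_univ_two]
  -- Step 2: the pointwise majorant (scale decomposition of the two lines, (5.18) on the third)
  have hstep2 : ∀ p : FMom d × FMom d, H p ≤ ENNReal.ofReal b *
      ∫⁻ σ in Ioi t ×ˢ Ioi t, scalePair M β (epsT M.eps0 t) (if v 0 then (1 : ℝ) else -1)
        (if v 1 then (1 : ℝ) else -1) Q.2 (p, σ) := by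
    intro p
    rw [← lineMajorants_mul_eq_lintegral_scalePair hM, hHdef]
    dsimp only
    have h1 := enorm_modelProp_toMats_le_lintegral_scaleLine hM hχ hβ t p.1
    have h2 := enorm_modelProp_toMats_le_lintegral_scaleLine hM hχ hβ t p.2
    obtain ⟨P, hPdef⟩ : ∃ P : FMom d, P = ((if v 0 then (1 : ℝ) else -1) • toMats β p.1 +
        (if v 1 then (1 : ℝ) else -1) • toMats β p.2) + Q := ⟨_, rfl⟩
    have hP2 : P.2 = (if v 0 then (1 : ℝ) else -1) • p.1.2 + (if v 1 then (1 : ℝ) else -1) • p.2.2 + Q.2 := by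
      rw [hPdef]; rfl
    have h3 : ‖multiMomPartial α (modelPropDot M χ₁ t) P‖ₑ ≤ ENNReal.ofReal b *
        (pairShell M (epsT M.eps0 t) (if v 0 then (1 : ℝ) else -1) (if v 1 then (1 : ℝ) else -1) Q.2).indicator
          1 (p.1.2, p.2.2) := by
      have h := h518t P.1 P.2
      have hi1 : (if |P.1| ≤ epsT M.eps0 t then (1 : ℝ) else 0) ≤ 1 := by split_ifs <;> norm_num
      have hi2 : 0 ≤ (if |M.E P.2| ≤ epsT M.eps0 t then (1 : ℝ) else 0) := by split_ifs <;> norm_num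
      have h' : ‖multiMomPartial α (modelPropDot M χ₁ t) P‖ ≤
          b * (if |M.E P.2| ≤ epsT M.eps0 t then (1 : ℝ) else 0) := by
        calc ‖multiMomPartial α (modelPropDot M χ₁ t) P‖
            ≤ b * (if |P.1| ≤ epsT M.eps0 t then (1 : ℝ) else 0) *
                (if |M.E P.2| ≤ epsT M.eps0 t then (1 : ℝ) else 0) := h
          _ ≤ b * 1 * (if |M.E P.2| ≤ epsT M.eps0 t then (1 : ℝ) else 0) := by gcongr
          _ = b * (if |M.E P.2| ≤ epsT M.eps0 t then (1 : ℝ) else 0) := by ring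
      rw [← ofReal_norm]
      refine (ENNReal.ofReal_le_ofReal h').trans (le_of_eq ?_)
      rw [hP2]
      by_cases hm : |M.E ((if v 0 then (1 : ℝ) else -1) • p.1.2 + (if v 1 then (1 : ℝ) else -1) • p.2.2 + Q.2)|
          ≤ epsT M.eps0 t
      · rw [if_pos hm, indicator_of_mem (show (p.1.2, p.2.2) ∈ pairShell M (epsT M.eps0 t)
          (if v 0 then (1 : ℝ) else -1) (if v 1 then (1 : ℝ) else -1) Q.2 from hm), mul_one]
        simp
      · rw [if_neg hm, indicator_of_notMem (show (p.1.2, p.2.2) ∉ pairShell M (epsT M.eps0 t)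
          (if v 0 then (1 : ℝ) else -1) (if v 1 then (1 : ℝ) else -1) Q.2 from hm)]
        simp
    have hw2 : ENNReal.ofReal (loopWeight d 2) = ENNReal.ofReal (loopWeight d 1) * ENNReal.ofReal (loopWeight d 1) := by
      rw [← ENNReal.ofReal_mul hw₁0, loopWeight_succ, loopWeight_eq_pow d 1, pow_one]
    rw [← hPdef]
    calc ENNReal.ofReal (loopWeight d 2) *
          (‖modelProp M χ₁ t (toMats β p.1)‖ₑ * ‖modelProp M χ₁ t (toMats β p.2)‖ₑ) *
        ‖multiMomPartial α (modelPropDot M χ₁ t) P‖ₑ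
        ≤ (ENNReal.ofReal (loopWeight d 1) * ENNReal.ofReal (loopWeight d 1)) *
          ((∫⁻ s in Ioi t, scaleLine M β s p.1) * (∫⁻ s in Ioi t, scaleLine M β s p.2)) *
            (ENNReal.ofReal b * (pairShell M (epsT M.eps0 t) (if v 0 then (1 : ℝ) else -1)
              (if v 1 then (1 : ℝ) else -1) Q.2).indicator 1 (p.1.2, p.2.2)) := by
          rw [hw2]; gcongr
      _ = ENNReal.ofReal b * ((ENNReal.ofReal (loopWeight d 1) * ∫⁻ s in Ioi t, scaleLine M β s p.1) *
          (ENNReal.ofReal (loopWeight d 1) * ∫⁻ s in Ioi t, scaleLine M β s p.2) *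
            (pairShell M (epsT M.eps0 t) (if v 0 then (1 : ℝ) else -1) (if v 1 then (1 : ℝ) else -1)
              Q.2).indicator 1 (p.1.2, p.2.2)) := mul_rearrange₂ _ _ _ _ _
  -- Steps 3–5: Tonelli (phase space first, at fixed scales), the fixed-scale volume bound, the scale integrals
  have hmeasI : MeasurableSet (Ioi t ×ˢ Ioi t) := measurableSet_Ioi.prod measurableSet_Ioi
  have hK : 0 ≤ 256 * loopWeight d 1 ^ 2 * V *
      (epsT M.eps0 t * (1 + (deltaTwo d : ℝ) * |Real.log (epsT M.eps0 t)|)) := by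
    have := hV.1; positivity
  calc ∫⁻ k in loopSet d M.latt 2,
        ENNReal.ofReal (loopWeight d 2) * (∏ j, ‖modelProp M χ₁ t (toMats β (k j))‖ₑ) *
          ‖multiMomPartial α (modelPropDot M χ₁ t) ((∑ j, (if v j then (1 : ℝ) else -1) • toMats β (k j)) + Q)‖ₑ
      = ∫⁻ p in ((univ : Set ℝ) ×ˢ bzBox d M.latt) ×ˢ ((univ : Set ℝ) ×ˢ bzBox d M.latt), H p := hstep1
    _ ≤ ∫⁻ p in ((univ : Set ℝ) ×ˢ bzBox d M.latt) ×ˢ ((univ : Set ℝ) ×ˢ bzBox d M.latt),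
          ENNReal.ofReal b * ∫⁻ σ in Ioi t ×ˢ Ioi t, scalePair M β (epsT M.eps0 t)
            (if v 0 then (1 : ℝ) else -1) (if v 1 then (1 : ℝ) else -1) Q.2 (p, σ) := lintegral_mono hstep2
    _ = ENNReal.ofReal b * ∫⁻ σ in Ioi t ×ˢ Ioi t,
          ∫⁻ p in ((univ : Set ℝ) ×ˢ bzBox d M.latt) ×ˢ ((univ : Set ℝ) ×ˢ bzBox d M.latt),
            scalePair M β (epsT M.eps0 t) (if v 0 then (1 : ℝ) else -1) (if v 1 then (1 : ℝ) else -1) Q.2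
              (p, σ) := by
        have hsw' := measurable_scalePair hM β (epsT M.eps0 t) (if v 0 then (1 : ℝ) else -1)
          (if v 1 then (1 : ℝ) else -1) Q.2
        have hsw : Measurable (Function.uncurry fun (p : FMom d × FMom d) (σ : ℝ × ℝ) =>
            scalePair M β (epsT M.eps0 t) (if v 0 then (1 : ℝ) else -1) (if v 1 then (1 : ℝ) else -1) Q.2
              (p, σ)) := hsw'
        rw [lintegral_const_mul' _ _ ENNReal.ofReal_ne_top,
          lintegral_lintegral_swap (f := fun (p : FMom d × FMom d) (σ : ℝ × ℝ) =>
            scalePair M β (epsT M.eps0 t) (if v 0 then (1 : ℝ) else -1) (if v 1 then (1 : ℝ) else -1) Q.2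
              (p, σ)) hsw.aemeasurable]
    _ ≤ ENNReal.ofReal b * ∫⁻ σ in Ioi t ×ˢ Ioi t, ENNReal.ofReal (256 * loopWeight d 1 ^ 2 * V *
          (epsT M.eps0 t * (1 + (deltaTwo d : ℝ) * |Real.log (epsT M.eps0 t)|)) *
            (epsT M.eps0 σ.1 * epsT M.eps0 σ.2)) := by
        gcongr 1
        exact setLIntegral_mono' hmeasI fun σ hσ =>
          setLIntegral_scalePair_le hM hV hβ ht (mem_Ioi.mp hσ.1) (mem_Ioi.mp hσ.2) (v 0) (v 1) Q.2
    _ = ENNReal.ofReal (b * (256 * loopWeight d 1 ^ 2 * V *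
          (epsT M.eps0 t ^ 3 * (1 + (deltaTwo d : ℝ) * |Real.log (epsT M.eps0 t)|)))) := by
        rw [lintegral_scales_eq hM.eps0_pos hK, ← ENNReal.ofReal_mul hb]
        congr 1
        ring

/-! ### Assembly: (6.9) for the many-fermion propagator -/

/-- The constant `K₀` of (6.9) produced by this proof (print: `K₀` of (6.14), from `J₀, J₁, |E|₁, g₀, Q_V, ε₀`;
here from the two-shell volume constant `V`, the constant `J₁` of (5.21), the loop normalisation
`w₁ = (2π)^{-(d+1)}` and `ε₀`): `K₀ = 8 w₁² max(V,1) (1 + |log ε₀|) / J₁²` — INDEPENDENT of `β`.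
[cite: Salmhofer1998, Lemma 7 (6.14) (p.23 L30–35)] -/
def volK₀ (M : ModelData d) (V J₁ : ℝ) : ℝ :=
  8 * loopWeight d 1 ^ 2 * max V 1 * (1 + |Real.log M.eps0|) / J₁ ^ 2

/-- `w₁ = (2π)^{-(d+1)} > 0`. [cite: Salmhofer1998, Lemma 4 (5.20)–(5.21) (p.19 L154–164)] -/
theorem loopWeight_one_pos (d : ℕ) : 0 < loopWeight d 1 := by
  unfold loopWeight; positivity

/-- `K₀ > 0`. [cite: Salmhofer1998, Lemma 7 (6.14) (p.23 L30–35)] -/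
theorem volK₀_pos (M : ModelData d) (V : ℝ) {J₁ : ℝ} (hJ : 0 < J₁) : 0 < volK₀ M V J₁ := by
  unfold volK₀
  have := loopWeight_one_pos d
  have : 0 < max V 1 := lt_max_of_lt_right one_pos
  positivity

/-- The logarithm of Lemma 6's bound at `ε = ε_t`, against print's factor `½(1+t)`:
`1 + δ_{d,2}|log ε_t| ≤ 2(1 + |log ε₀|) · ((1+t)/2)^{δ_{d,2}}` for `t ≥ 0`.
[cite: Salmhofer1998, Lemma 7 (6.9) (p.22 L124–129) and proof (6.13)–(6.14) (p.23 L23–35)] -/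
theorem logFactor_le_twoLoopFactor (M : ModelData d) {t : ℝ} (ht : 0 ≤ t) :
    1 + (deltaTwo d : ℝ) * |Real.log (epsT M.eps0 t)| ≤
      2 * (1 + |Real.log M.eps0|) * twoLoopFactor d t := by
  unfold deltaTwo twoLoopFactor epsT
  have hlog : |Real.log (M.eps0 * Real.exp (-t))| ≤ |Real.log M.eps0| + t := by
    by_cases h0 : M.eps0 = 0
    · simp [h0]; exact ht
    · rw [Real.log_mul h0 (Real.exp_ne_zero _), Real.log_exp]
      calc |Real.log M.eps0 + -t| ≤ |Real.log M.eps0| + |-t| := abs_add_le _ _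
        _ = |Real.log M.eps0| + t := by rw [abs_neg, abs_of_nonneg ht]
  split_ifs with hd
  · push_cast
    have h1 : 0 ≤ |Real.log M.eps0| := abs_nonneg _
    nlinarith
  · push_cast
    have h1 : 0 ≤ |Real.log M.eps0| := abs_nonneg _
    nlinarith

/-- Powers of the scale collected: `ε_t^{-1-|α|} · ε_t³ · ε_t^m = ε_t^{i-1-|α|}` with `i = 3 + m` (integer
exponent, as in (6.9)). [cite: Salmhofer1998, Lemma 7 (6.9) (p.22 L124–128)] -/
theorem epsPow_combine {ε : ℝ} (hε : 0 < ε) (a m : ℕ) :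
    ε⁻¹ ^ (1 + a) * ε ^ 3 * ε ^ m = ε ^ (((2 + m : ℕ) : ℤ) - (a : ℤ)) := by
  have hε0 : ε ≠ 0 := hε.ne'
  rw [← zpow_natCast, ← zpow_natCast, ← zpow_natCast, inv_zpow', ← zpow_add₀ hε0, ← zpow_add₀ hε0]
  congr 1
  push_cast
  ring

/-- **Lemma 7, (6.9), for the many-fermion propagator at one `(β, t, α)`** — the core estimate: given (5.18)
for `D^α Ċ_t` with constant `B_α`, (5.21) with `J₁` at this `(β,t)`, and the two-shell volume bound with `V`,
for every number `2 + m` of integrated lines (`i = 3 + m ≥ 3`):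
`Y_{α,i}(t) ≤ (8J₁)^{i-1} B_α K₀ ((1+t)/2)^{δ_{d,2}} ε_t^{i-1-|α|}` with `K₀ = volK₀ M V J₁` independent of `β`.
[cite: Salmhofer1998, Lemma 7 (6.9) (p.22 L124–131), proof (6.10)–(6.14) (p.22 L143 – p.23 L35)] -/
theorem loopY_modelProp_le_69_core {M : ModelData d} (hM : M.Hyp) {χ₁ : ℝ → ℝ} (hχ : IsCutoff χ₁)
    {V : ℝ} (hV : TwoShellVolumeBound M V) {β : ℝ} (hβ : 0 < β) {t : ℝ} (ht : 0 ≤ t)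
    {α : Fin d → ℕ} {Bα : ℝ} (hBα : 0 ≤ Bα)
    (h518t : ∀ (x : ℝ) (p : Mom d), ‖multiMomPartial α (modelPropDot M χ₁ t) (x, p)‖ ≤
        Bα * (epsT M.eps0 t)⁻¹ ^ (1 + miDeg α) *
          (if |x| ≤ epsT M.eps0 t then (1 : ℝ) else 0) * (if |M.E p| ≤ epsT M.eps0 t then (1 : ℝ) else 0))
    {J₁ : ℝ} (hJ : 0 < J₁) (h521t : Display521 M χ₁ β J₁ t) (m : ℕ) :
    loopY M.latt β (modelProp M χ₁) (modelPropDot M χ₁) α (2 + m) t ≤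
      ENNReal.ofReal ((8 * J₁) ^ (2 + m) * Bα * volK₀ M V J₁ * twoLoopFactor d t *
        epsT M.eps0 t ^ (((2 + m : ℕ) : ℤ) - (miDeg α : ℤ))) := by
  have hε := epsT_pos hM.eps0_pos t
  have hw := loopWeight_one_pos d
  have hV0 := hV.1
  set ε := epsT M.eps0 t with hεdef
  set ℓ : ℝ := 1 + (deltaTwo d : ℝ) * |Real.log ε| with hℓdef
  have hℓ0 : 0 ≤ ℓ := by rw [hℓdef]; positivity
  set b : ℝ := Bα * ε⁻¹ ^ (1 + miDeg α) with hbdef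
  have hb : 0 ≤ b := by rw [hbdef]; positivity
  -- the two overlapping lines
  have h2 : loopY M.latt β (modelProp M χ₁) (modelPropDot M χ₁) α 2 t ≤
      ENNReal.ofReal (b * (256 * loopWeight d 1 ^ 2 * V * (ε ^ 3 * ℓ))) :=
    loopY_two_modelProp_le hM hχ hV hβ ht hb (fun x p => by
      have := h518t x p; rw [hbdef]; linarith [this])
  -- the remaining `m` lines, (5.21)
  have hL1 : propL1 M.latt β (modelProp M χ₁) t ≤ ENNReal.ofReal (8 * J₁ * ε) := by
    rw [propL1_modelProp]; exact h521t
  have hpeel := loopY_le_loopY_two_mul_pow M.latt β α (measurable_modelProp_toMats hM hχ β t) m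
    (C := modelProp M χ₁) (Cdot := modelPropDot M χ₁)
  calc loopY M.latt β (modelProp M χ₁) (modelPropDot M χ₁) α (2 + m) t
      ≤ loopY M.latt β (modelProp M χ₁) (modelPropDot M χ₁) α 2 t * propL1 M.latt β (modelProp M χ₁) t ^ m :=
        hpeel
    _ ≤ ENNReal.ofReal (b * (256 * loopWeight d 1 ^ 2 * V * (ε ^ 3 * ℓ))) * ENNReal.ofReal (8 * J₁ * ε) ^ m := by
        gcongr
    _ = ENNReal.ofReal (b * (256 * loopWeight d 1 ^ 2 * V * (ε ^ 3 * ℓ)) * (8 * J₁ * ε) ^ m) := by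
        rw [← ENNReal.ofReal_pow (by positivity), ← ENNReal.ofReal_mul (by positivity)]
    _ ≤ ENNReal.ofReal ((8 * J₁) ^ (2 + m) * Bα * volK₀ M V J₁ * twoLoopFactor d t *
          ε ^ (((2 + m : ℕ) : ℤ) - (miDeg α : ℤ))) := by
        apply ENNReal.ofReal_le_ofReal
        rw [hbdef, ← epsPow_combine hε (miDeg α) m]
        have hℓb : ℓ ≤ 2 * (1 + |Real.log M.eps0|) * twoLoopFactor d t := logFactor_le_twoLoopFactor M ht
        have hVle : V ≤ max V 1 := le_max_left _ _
        have htlf : 0 ≤ twoLoopFactor d t := by unfold twoLoopFactor; split_ifs <;> linarith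
        have hK : volK₀ M V J₁ * (8 * J₁) ^ 2 = 512 * loopWeight d 1 ^ 2 * max V 1 * (1 + |Real.log M.eps0|) := by
          unfold volK₀; field_simp; ring
        -- `LHS = Bα ε⁻¹^{1+a} ε³ ε^m · (8J₁)^m · 256 w² · V · ℓ`, `RHS = … · (8J₁)^m (8J₁)² K₀ tlf`
        have hcore : 256 * loopWeight d 1 ^ 2 * V * ℓ ≤ (8 * J₁) ^ 2 * volK₀ M V J₁ * twoLoopFactor d t := by
          calc 256 * loopWeight d 1 ^ 2 * V * ℓ
              ≤ 256 * loopWeight d 1 ^ 2 * max V 1 * (2 * (1 + |Real.log M.eps0|) * twoLoopFactor d t) := by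
                gcongr
          _ = (8 * J₁) ^ 2 * volK₀ M V J₁ * twoLoopFactor d t := by rw [mul_comm ((8 * J₁) ^ 2), hK]; ring
        have hpos : 0 ≤ Bα * (ε⁻¹ ^ (1 + miDeg α) * ε ^ 3 * ε ^ m) * (8 * J₁) ^ m := by positivity
        calc Bα * ε⁻¹ ^ (1 + miDeg α) * (256 * loopWeight d 1 ^ 2 * V * (ε ^ 3 * ℓ)) * (8 * J₁ * ε) ^ m
            = Bα * (ε⁻¹ ^ (1 + miDeg α) * ε ^ 3 * ε ^ m) * (8 * J₁) ^ m * (256 * loopWeight d 1 ^ 2 * V * ℓ) := by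
              ring
          _ ≤ Bα * (ε⁻¹ ^ (1 + miDeg α) * ε ^ 3 * ε ^ m) * (8 * J₁) ^ m *
              ((8 * J₁) ^ 2 * volK₀ M V J₁ * twoLoopFactor d t) := mul_le_mul_of_nonneg_left hcore hpos
          _ = (8 * J₁) ^ (2 + m) * Bα * volK₀ M V J₁ * twoLoopFactor d t *
              (ε⁻¹ ^ (1 + miDeg α) * ε ^ 3 * ε ^ m) := by ring


/-- **Lemma 7, clause (6.9), for the many-fermion propagator (5.17)** — in the binder shape of the named fact
`OverlappingLoopBound` (the hypothesis of `overlappingLoopBound_of_69`): for a model of the §2.3 class in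
`d ≥ 2` with a cutoff `χ₁`, constants `B_α ≥ 0`, `J₁ > 0` for which (5.18) and (5.21) hold in the window
`βε₀ ≥ 6`, and the two-shell volume bound with constant `V`, there is `K₀ > 0` INDEPENDENT of `β` with
`Y_{α,i}(t) ≤ (8J₁)^{i-1} B_α K₀ ((1+t)/2)^{δ_{d,2}} ε_t^{i-1-|α|}` for all `β` in the window, `t ≥ 0`,
`|α| ≤ k₀`, `i ≥ 3`.  `K₀ = volK₀ M V J₁`. [cite: Salmhofer1998, Lemma 7 (6.9) (p.22 L124–131)] -/
theorem loopY_modelProp_le_69_of_twoShellVolume {M : ModelData d} (hM : M.Hyp) {χ₁ : ℝ → ℝ}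
    (hχ : IsCutoff χ₁) {V : ℝ} (hV : TwoShellVolumeBound M V) (B : (Fin d → ℕ) → ℝ) (J₁ : ℝ)
    (hB : ∀ α, 0 ≤ B α) (hJ : 0 < J₁)
    (h518 : ∀ β : ℝ, 0 < β → 6 ≤ β * M.eps0 → ∀ t : ℝ, 0 ≤ t → ∀ α : Fin d → ℕ, miDeg α ≤ M.k0 →
      ∀ (x : ℝ) (p : Mom d),
        ‖multiMomPartial α (modelPropDot M χ₁ t) (x, p)‖ ≤
          B α * (epsT M.eps0 t)⁻¹ ^ (1 + miDeg α) *
            (if |x| ≤ epsT M.eps0 t then 1 else 0) * (if |M.E p| ≤ epsT M.eps0 t then 1 else 0))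
    (h521 : ∀ β : ℝ, 0 < β → 6 ≤ β * M.eps0 → ∀ t : ℝ, 0 ≤ t → Display521 M χ₁ β J₁ t) :
    ∃ K₀ : ℝ, 0 < K₀ ∧
      ∀ β : ℝ, 0 < β → 6 ≤ β * M.eps0 → ∀ t : ℝ, 0 ≤ t → ∀ α : Fin d → ℕ, miDeg α ≤ M.k0 →
        ∀ i : ℕ, 3 ≤ i →
          loopY M.latt β (modelProp M χ₁) (modelPropDot M χ₁) α (i - 1) t ≤
            ENNReal.ofReal ((8 * J₁) ^ (i - 1) * B α * K₀ * twoLoopFactor d t *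
              epsT M.eps0 t ^ ((i : ℤ) - 1 - (miDeg α : ℤ))) := by
  refine ⟨volK₀ M V J₁, volK₀_pos M V hJ, fun β hβ h6 t ht α hα i hi => ?_⟩
  obtain ⟨m, rfl⟩ : ∃ m, i = m + 3 := ⟨i - 3, by omega⟩
  have h1 : m + 3 - 1 = 2 + m := by omega
  have h2 : ((m + 3 : ℕ) : ℤ) - 1 - (miDeg α : ℤ) = ((2 + m : ℕ) : ℤ) - (miDeg α : ℤ) := by push_cast; ring
  rw [h1, h2]
  exact loopY_modelProp_le_69_core hM hχ hV hβ ht (hB α) (h518 β hβ h6 t ht α hα) hJ (h521 β hβ h6 t ht) m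

/-- **`OverlappingLoopBound` (Lemma 7, licence F-091) follows from the two-shell volume bound for every model
of the §2.3 class** — its clauses (o) and (6.8) being theorems (`Salmhofer1998OverlappingLoopInputs`) and (6.9)
the theorem above: the named fact is reduced to the phase-space geometry of (6.11)–(6.12), i.e. to Lemma 6
(= [FST2] Theorem 1.1, tree `FermiRG.VolumeBound`) read through the low-energy chart of §2.3.  No new fact:
the geometric statement is this theorem's hypothesis. [cite: Salmhofer1998, Lemma 7 (p.22 L117 – p.23 L37)] -/
theorem overlappingLoopBound_of_twoShellVolume
    (hvol : ∀ (d : ℕ) (M : ModelData d), 2 ≤ d → M.Hyp → d < M.k0 → ∃ V : ℝ, TwoShellVolumeBound M V) :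
    OverlappingLoopBound :=
  overlappingLoopBound_of_69 fun d M hd hM hk χ₁ hχ B J₁ hB hJ h518 h521 => by
    obtain ⟨V, hV⟩ := hvol d M hd hM hk
    exact loopY_modelProp_le_69_of_twoShellVolume hM hχ hV B J₁ hB hJ h518 h521

/-- **The standing hypothesis of Theorems 3–7 for the many-fermion propagator, from the two-shell volume
bound alone**: for a model of the §2.3 class with a cutoff `χ₁` and `TwoShellVolumeBound M V` there are
constants `B, K₀, J₁ > 0` (those of Lemma 4 — `B = max(B₀,B₁,B₂)`, `J₁` of (5.21) — and `K₀ = volK₀ M V J₁`),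
independent of `β`, such that `LoopBoundsHold … (modelProp M χ₁) (modelPropDot M χ₁) B K₀ J₁` for EVERY
`β > 0`: both (6.8) (tree `loopY_modelProp_le`) and (6.9) (this file) for `|α| ≤ 2`.
[cite: Salmhofer1998, Lemma 7 (6.8)–(6.9) (p.22 L117–131) and Theorem 6 (p.24 L107–115)] -/
theorem loopBoundsHold_modelProp_of_twoShellVolume {M : ModelData d} (hM : M.Hyp) {χ₁ : ℝ → ℝ}
    (hχ : IsCutoff χ₁) {V : ℝ} (hV : TwoShellVolumeBound M V) :
    ∃ B K₀ J₁ : ℝ, 0 < B ∧ 0 < K₀ ∧ 0 < J₁ ∧ ∀ β : ℝ, 0 < β →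
      LoopBoundsHold M.latt β M.eps0 (modelProp M χ₁) (modelPropDot M χ₁) B K₀ J₁ := by
  obtain ⟨Bf, -, hBpos, h518⟩ := exists_bound518_multiMomPartial hM hχ
  obtain ⟨J₁, hJ, -, h521⟩ := exists_display521 hM hχ
  set Bm : ℝ := max (Bf 0) (max (Bf 1) (Bf 2)) with hBm
  have hBm_pos : 0 < Bm := lt_max_of_lt_left (hBpos 0)
  have hBle : ∀ α : Fin d → ℕ, miDeg α ≤ 2 → Bf (miDeg α) ≤ Bm := by
    intro α hα
    rcases Nat.lt_or_ge (miDeg α) 1 with h0 | h1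
    · rw [show miDeg α = 0 by omega]; exact le_max_left _ _
    · rcases Nat.lt_or_ge (miDeg α) 2 with h1' | h2
      · rw [show miDeg α = 1 by omega]; exact le_max_of_le_right (le_max_left _ _)
      · rw [show miDeg α = 2 by omega]; exact le_max_of_le_right (le_max_right _ _)
  refine ⟨Bm, volK₀ M V J₁, J₁, hBm_pos, volK₀_pos M V hJ, hJ, fun β hβ => ⟨?_, ?_⟩⟩
  · -- (6.8)
    intro t ht α hα i hi
    have hk : miDeg α ≤ M.k0 := hα.trans hM.two_le_k0
    have h := loopY_modelProp_le hM hχ (B := fun α => Bf (miDeg α)) (fun α => (hBpos _).le) hJ.le h518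
      (h521 β hβ) ht hk hi
    refine h.trans (ENNReal.ofReal_le_ofReal ?_)
    have hε := epsT_pos hM.eps0_pos t
    have h1 : 0 ≤ (8 * J₁) ^ (i - 1) * epsT M.eps0 t ^ ((i : ℤ) - 2 - (miDeg α : ℤ)) :=
      mul_nonneg (by positivity) (zpow_pos hε _).le
    calc (8 * J₁) ^ (i - 1) * Bf (miDeg α) * epsT M.eps0 t ^ ((i : ℤ) - 2 - (miDeg α : ℤ))
        = (8 * J₁) ^ (i - 1) * epsT M.eps0 t ^ ((i : ℤ) - 2 - (miDeg α : ℤ)) * Bf (miDeg α) := by ring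
      _ ≤ (8 * J₁) ^ (i - 1) * epsT M.eps0 t ^ ((i : ℤ) - 2 - (miDeg α : ℤ)) * Bm :=
          mul_le_mul_of_nonneg_left (hBle α hα) h1
      _ = (8 * J₁) ^ (i - 1) * Bm * epsT M.eps0 t ^ ((i : ℤ) - 2 - (miDeg α : ℤ)) := by ring
  · -- (6.9)
    intro t ht α hα i hi
    have hk : miDeg α ≤ M.k0 := hα.trans hM.two_le_k0
    obtain ⟨m, rfl⟩ : ∃ m, i = m + 3 := ⟨i - 3, by omega⟩
    have h1 : m + 3 - 1 = 2 + m := by omega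
    have h2 : ((m + 3 : ℕ) : ℤ) - 1 - (miDeg α : ℤ) = ((2 + m : ℕ) : ℤ) - (miDeg α : ℤ) := by push_cast; ring
    rw [h1, h2]
    have h := loopY_modelProp_le_69_core hM hχ hV hβ ht (hBpos (miDeg α)).le (h518 t ht α hk) hJ
      (h521 β hβ t ht) m
    refine h.trans (ENNReal.ofReal_le_ofReal ?_)
    have hε := epsT_pos hM.eps0_pos t
    have htlf : 0 ≤ twoLoopFactor d t := by unfold twoLoopFactor; split_ifs <;> linarith
    have hK := volK₀_pos M V hJ
    have h3 : 0 ≤ (8 * J₁) ^ (2 + m) * volK₀ M V J₁ * twoLoopFactor d t *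
        epsT M.eps0 t ^ (((2 + m : ℕ) : ℤ) - (miDeg α : ℤ)) :=
      mul_nonneg (by positivity) (zpow_pos hε _).le
    calc (8 * J₁) ^ (2 + m) * Bf (miDeg α) * volK₀ M V J₁ * twoLoopFactor d t *
          epsT M.eps0 t ^ (((2 + m : ℕ) : ℤ) - (miDeg α : ℤ))
        = (8 * J₁) ^ (2 + m) * volK₀ M V J₁ * twoLoopFactor d t *
          epsT M.eps0 t ^ (((2 + m : ℕ) : ℤ) - (miDeg α : ℤ)) * Bf (miDeg α) := by ring
      _ ≤ (8 * J₁) ^ (2 + m) * volK₀ M V J₁ * twoLoopFactor d t *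
          epsT M.eps0 t ^ (((2 + m : ℕ) : ℤ) - (miDeg α : ℤ)) * Bm := mul_le_mul_of_nonneg_left (hBle α hα) h3
      _ = (8 * J₁) ^ (2 + m) * Bm * volK₀ M V J₁ * twoLoopFactor d t *
          epsT M.eps0 t ^ (((2 + m : ℕ) : ℤ) - (miDeg α : ℤ)) := by ring

/-- **Lemma 7 in full for a model with the two-shell volume bound**: all three conclusions of
`OverlappingLoopBound` — (o), (6.8), (6.9) — hold for THIS model (the named fact quantifies over all models;
this is its instance, unconditionally in the propagator analysis, conditionally only on the model's
phase-space geometry `TwoShellVolumeBound M V`). [cite: Salmhofer1998, Lemma 7 (p.22 L117 – p.23 L37)] -/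
theorem lemma7_modelProp_of_twoShellVolume {M : ModelData d} (hd : 2 ≤ d) (hM : M.Hyp) (hk : d < M.k0)
    {χ₁ : ℝ → ℝ} (hχ : IsCutoff χ₁) {V : ℝ} (hV : TwoShellVolumeBound M V)
    (B : (Fin d → ℕ) → ℝ) (J₁ : ℝ) (hB : ∀ α, 0 ≤ B α) (hJ : 0 < J₁)
    (h518 : ∀ β : ℝ, 0 < β → 6 ≤ β * M.eps0 → ∀ t : ℝ, 0 ≤ t → ∀ α : Fin d → ℕ, miDeg α ≤ M.k0 →
      ∀ (x : ℝ) (p : Mom d),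
        ‖multiMomPartial α (modelPropDot M χ₁ t) (x, p)‖ ≤
          B α * (epsT M.eps0 t)⁻¹ ^ (1 + miDeg α) *
            (if |x| ≤ epsT M.eps0 t then 1 else 0) * (if |M.E p| ≤ epsT M.eps0 t then 1 else 0))
    (h521 : ∀ β : ℝ, 0 < β → 6 ≤ β * M.eps0 → ∀ t : ℝ, 0 ≤ t → Display521 M χ₁ β J₁ t) :
    (∀ β : ℝ, 0 < β → 6 ≤ β * M.eps0 → ∀ t : ℝ, Real.log (β * M.eps0 / Real.pi) < t →
      ∀ (α : Fin d → ℕ) (n : ℕ), loopYM M.latt β (modelProp M χ₁) (modelPropDot M χ₁) α n t = 0) ∧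
    (∀ β : ℝ, 0 < β → 6 ≤ β * M.eps0 → ∀ t : ℝ, 0 ≤ t → ∀ α : Fin d → ℕ, miDeg α ≤ M.k0 →
      ∀ i : ℕ, 1 ≤ i →
        loopY M.latt β (modelProp M χ₁) (modelPropDot M χ₁) α (i - 1) t ≤
          ENNReal.ofReal ((8 * J₁) ^ (i - 1) * B α * epsT M.eps0 t ^ ((i : ℤ) - 2 - (miDeg α : ℤ)))) ∧
    ∃ K₀ : ℝ, 0 < K₀ ∧
      ∀ β : ℝ, 0 < β → 6 ≤ β * M.eps0 → ∀ t : ℝ, 0 ≤ t → ∀ α : Fin d → ℕ, miDeg α ≤ M.k0 →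
        ∀ i : ℕ, 3 ≤ i →
          loopY M.latt β (modelProp M χ₁) (modelPropDot M χ₁) α (i - 1) t ≤
            ENNReal.ofReal ((8 * J₁) ^ (i - 1) * B α * K₀ * twoLoopFactor d t *
              epsT M.eps0 t ^ ((i : ℤ) - 1 - (miDeg α : ℤ))) :=
  ⟨overlappingLoopBound_o d M hM χ₁ hχ, overlappingLoopBound_68 d M hd hM hk χ₁ hχ B J₁ hB hJ h518 h521,
    loopY_modelProp_le_69_of_twoShellVolume hM hχ hV B J₁ hB hJ h518 h521⟩

end Salmhofer1998

end Literature.MathematicalPhysics.QuantumLattice.FermiRG
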